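import Mathlib
import Literature.MathematicalPhysics.QuantumFieldTheory.MullerSchiemann1987.MS87HeatKernelSU2
import Literature.MathematicalPhysics.QuantumFieldTheory.MullerSchiemann1987.MS87HeatKernelLargeGamma
import HarnessLib

/-!
# Müller–Schiemann, *Continuum limit of a hierarchical SU(2) lattice gauge theory in 4 dimensions*
# (CMP 110, 1987), APPENDIX for COMPLEX angles: the Gibbs factor `h` of (A.1) as an entire function, the
# theta-inversion formulas (A.7)/(A.8) on `ℂ`, the bounds (A.10)/(A.11) on the full strips `𝒟`, `𝒟̌` (v1.2), and the
# APPENDIX LEMMA part (iv) AS PRINTED — «in {|θ| > β^{−α}, |Re θ| ≤ π, |Im θ| < (κ/2)β^{−α}}: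
# |h(θ)| < exp{β(Im θ)² − pβ^{1−2α}}, p = 5/8» — PROVED

statement-level skeleton of published theorems with citation tags; proofs where landed; nothing here is a claim about the Yang–Mills mass gap

**Citation header (reproduction of PUBLISHED work).** V. F. Müller, J. Schiemann, *Continuum limit of a hierarchical
SU(2) lattice gauge theory in 4 dimensions*, Commun. Math. Phys. **110** (1987) 261–286, doi 10.1007/BF01207367
[MullerSchiemann1987], APPENDIX pp. 284–285 (the Lemma, (A.1), (A.7)–(A.8), (A.10)–(A.11)) and Sect. 3 p.266
((A₁): `g(u, z)` «entire holomorphic in z»). Loci `p.NNN L.nn` = journal page and text-layer line of the held Project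
Euclid scan `paper:url-96df5da18d4c` (PDF page = journal page − 260); displays read on the renders filed by the lit-balaban
YM LIT SWEEP fit-ref B (`inprint/lit-balaban-p18/renders-cmp110ms/g43/hierSU2-1987-cmp110-p024-x2.png`, `-p025-x2.png`).
Fifth file of `MullerSchiemann1987/`; continuation of `MS87HeatKernelSU2` (v1.4: (A.1)–(A.9), Lemma (i)–(iii) on `ℝ`)
and `MS87HeatKernelLargeGamma` (v1.1: (A.8), (A.10)–(A.11) and Lemma (iv) on the real axis; `betaIV`,
`tendsto_rho1_zero`), same namespace `…MullerSchiemann1987.HeatKernel`. Lean lane of the lit-balaban YM LIT SWEEP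
CONTEXT row X1 (register level, zero weight for any token of that table).

**What the paper prints (verbatim; displays image-read).**
* p.284, the APPENDIX LEMMA, part (iv) (after (i) `h(θ) > 0`, (ii) strict decrease, (iii) the Taylor expansion of
  `−ln h`): *«(iv) In {|θ| > β^{−α}, |Re θ| ≤ π, |Im θ| < (κ/2)β^{−α}}, |h(θ)| < exp{β(Im θ)² − pβ^{1−2α}} with a
  constant p = 5/8 and β := γ − 1/6 + ρ₁ large enough. (κ and α are defined in Sect. 3.)»* — Sect. 3 (3.5) p.266:
  «|z| < β^{−α}, with 3/7 ≤ α < 1/2 (fixed)»; `κ` is the constant of the nonperturbative bound (A₂) p.267.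
* p.285 L.5–17: *«Due to Poisson's formula [(A.7)] … and with θ̌ = π − θ … [(A.8)]. Both representations are explicitly
  holomorphic in their respective domains.»*; L.18–22: *«From (A.7) we read off (iii). Moreover we deduce from (A.7)
  and (A.8) bounds, valid for γ → ∞, |h(θ)| ≤ exp{−γ Re θ² + 𝒪(1)}, θ ∈ 𝒟, (A.10)  |h(θ)| ≤ exp{−γπ(π − 2δ) −
  γ Re θ̌² + 𝒪(ln γ)}, |Re θ̌| ≤ δ. (A.11)  From these bounds follows (iv) observing that p < 1 − κ²/4 +
  𝒪(β^{−1+2α}). ∎»*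

**What is reproduced here (kernel-checked: zero `sorry`, zero named facts, axioms standard).**
* §1–§2 — **`h` on `ℂ`**: `hC γ θ = 𝒩 Σ_{l≥0} (l+1) e^{−(l+1)²/(4γ)} U_l(cos θ)` with Mathlib's Chebyshev polynomials of
  the second kind (`U_l(cos θ) sin θ = sin (l+1)θ`, `Polynomial.Chebyshev.U_complex_cos`) — the series (A.1)
  `𝒩 Σ_{l≥1} l e^{−l²/(4γ)} sin lθ / sin θ` with its removable singularities filled in. From `‖U_l(c)‖ ≤ (1 + 2‖c‖)^l`
  and `‖cos θ‖ ≤ e^{|Im θ|}` the series converges locally uniformly: **`hC` is entire** (`differentiable_hC`;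
  the print's «explicitly holomorphic», (A₁) «entire holomorphic in z»), `hC · sin = 𝒩 Σ c_l sin (l+1)θ` (`hC_mul_sin`),
  and **`hC = h` on `ℝ`** (`hC_ofReal`: agreement where `sin ≠ 0`, a dense set, plus continuity), `hC 0 = 1`, `hC` even
  and `2π`-periodic.
* §3 — **(A.7) ON `ℂ`** (`hC_mul_sin_eq_A7`): for every complex `θ`,
  `h(θ) sin θ = 𝒩′ e^{−γθ²} Σ_{n∈ℤ} (θ − 2πn) e^{4πγnθ − 4π²γn²}`; the right-hand series is entire
  (`differentiable_tsum_termA7C`, Gaussian majorants on rectangles via Mathlib's `hasSum_jacobiTheta₂_term`), both sides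
  agree on `ℝ` (`MS87HeatKernelSU2.h_mul_sin_eq_periodicGaussian`), hence everywhere by the identity theorem
  (`AnalyticOnNhd.eq_of_frequently_eq`); and, pairing `n ↔ −n`, the PRINTED form
  `h(θ) sin θ = 𝒩′e^{−γθ²}{θ + 2Σ_{n≥1}[θ cosh 4πγnθ − 2πn sinh 4πγnθ]e^{−4π²γn²}}` (`hC_mul_sin_eq_A7_brace`, v1.1).
* §4 — the core of (A.10)/(A.11) with the modulus of `e^{−γθ²}` explicit (`norm_hC_mul_sin_le`): for `γ ≥ 1`,
  `|Re θ| ≤ π`, `|Im θ| ≤ 1`, **`‖h(θ) sin θ‖ ≤ 2K e^{γ(Im θ)² − γ(Re θ)²}`**, `K = e^{2π²}Σ_{n∈ℤ}(π + 1 + 2π|n|)e^{−2π²n²}`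
  (`KP`): termwise `4πγn Re θ − 4π²γn² ≤ −4π²γ|n|(|n| − 1) ≤ 2π² − 2π²n²` and (A.9) `𝒩′ ≤ 2`.
* §5 — `|sin θ|² = sin²(Re θ) + sinh²(Im θ)`, hence `|sin θ| ≥ |sin Re θ|`, `≥ |Im θ|`, and Jordan's
  `|sin θ| ≥ (2/π)|θ|` for `|Re θ| ≤ π/2`; and, by the MAXIMUM PRINCIPLE on the disc `|w − π| ≤ 1`
  (`Complex.norm_le_of_forall_mem_frontier_norm_le`), **`‖h(θ)‖ ≤ πK e^{−γπ(π−2)}` for `‖θ ∓ π‖ ≤ 1`**, `γ ≥ 1`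
  (`norm_hC_le_near_pi`, `norm_hC_le_near_neg_pi`) — the role of (A.8)/(A.11) near `Re θ = ±π`, where `sin θ` vanishes.
* §6 — **LEMMA (iv)** (`lemma_iv`): for `0 < α < 1/2` and `κ² < 3/2` (i.e. `p = 5/8 < 1 − κ²/4`) there is `γ₀` such that
  for all `γ ≥ γ₀`, with `β = γ − 1/6 + ρ₁(γ)` (`betaIV`), every `θ ∈ ℂ` with `β^{−α} < |θ|`, `|Re θ| ≤ π`,
  `|Im θ| < (κ/2)β^{−α}` satisfies **`‖hC γ θ‖ < exp(β(Im θ)² − (5/8)β^{1−2α})`**. Proof as the print indicates: `ρ₁ → 0`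
  (`tendsto_rho1_zero`), so eventually `β ≤ γ ≤ β + 1/3` and `β → ∞` (`tendsto_betaIV_atTop`); on `|Re θ| ≤ π − ½`,
  §4 and `|sin θ| ≥ β^{−α}/π` give `‖h‖ ≤ 2πKβ^{α}e^{γ(Im θ)² − γ(Re θ)²}` with
  `γ((Im θ)² − (Re θ)²) < 2γ(Im θ)² − γβ^{−2α}`, `(2γ − β)(Im θ)² ≤ (β + 2/3)(κ²/4)β^{−2α}`, `γβ^{−2α} ≥ β^{1−2α}`,
  which wins as soon as `log(2πK) + κ²/6 + α log β ≤ (3/8 − κ²/4)β^{1−2α}` (`log β = o(β^{1−2α})`); on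
  `π − ½ < |Re θ| ≤ π`, §5 gives `‖h‖ ≤ πKe^{−γπ(π−2)} < e^{−(5/8)γ} ≤ e^{β(Im θ)² − (5/8)β^{1−2α}}`.

* §7 (v1.2) — **(A.10) ON THE WHOLE STRIP `𝒟 = {|Re θ| ≤ π − δ}`** (`norm_hC_le_A10`, `norm_hC_le_exp_A10`): for
  `0 < δ ≤ π/2`, `γ ≥ 1` and every complex `θ` with `|Re θ| ≤ π − δ` (imaginary part unrestricted),
  **`‖h(θ)‖ ≤ 2(1 + 2M(δ))(π/sin δ) e^{γ(Im θ)² − γ(Re θ)²}`**, i.e. `‖h(θ)‖ ≤ exp{−γ Re(θ²) + A(δ)}` — the printed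
  «|h(θ)| ≤ exp{−γ Re θ² + 𝒪(1)}, θ ∈ 𝒟»: from (A.7) on `ℂ` in the printed form, the termwise bound
  `‖[θ cosh(a_nθ) − 2π(n+1) sinh(a_nθ)]w_n‖ ≤ ‖θ‖(1 + 4π(n+1)²/δ)e^{−2πδ(n+1)}` (via `‖cosh w‖ ≤ e^{|Re w|}`,
  `‖sinh w‖ ≤ ‖w‖cosh(Re w)`), `M(δ) = MA10` of `MS87HeatKernelLargeGamma`, (A.9), and `‖θ‖ ≤ (π/sin δ)‖sin θ‖` on `𝒟`.
* §8 (v1.2) — **(A.8) ON `ℂ`** (`hC_mul_sin_eq_A8`, identity theorem from `MS87HeatKernelLargeGamma.h_mul_sin_eq_A8`) and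
  **(A.11) ON THE WHOLE STRIP `{|Re θ̌| ≤ δ}`** (`norm_hC_le_A11`, `norm_hC_le_exp_A11`): for `0 < δ ≤ π/2`, `γ ≥ 1`
  and every complex `θ̌` with `|Re θ̌| ≤ δ`, **`‖h(π − θ̌)‖ ≤ 2π((1 + 2π²γ) + M₁₁) e^{−γπ(π−2δ) + γ(Im θ̌)² − γ(Re θ̌)²}`**,
  i.e. `≤ exp{−γπ(π−2δ) − γ Re(θ̌²) + log(A + Bγ)}` — the printed «|h(θ)| ≤ exp{−γπ(π − 2δ) − γ Re θ̌² + 𝒪(ln γ)},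
  |Re θ̌| ≤ δ» (`M₁₁ = MA11`).

**Readings (declared).** (a) The print's `h(θ)` for complex `θ` is «the analytic continuation» (Sect. 2–3) of the class
function (2.20); it is realised as `hC` (§2), which is entire and restricts to the `h` of `MS87HeatKernelSU2` on `ℝ`.
(b) «β := γ − 1/6 + ρ₁ large enough» is realised as «`γ ≥ γ₀`» for a threshold depending on `α`, `κ` — equivalent
since `|β − γ + 1/6| = |ρ₁(γ)| → 0`; no explicit `γ₀` is given (the print gives none). (c) The hypothesis on `κ` is
exactly the print's «observing that p < 1 − κ²/4» with `p = 5/8`, i.e. `κ² < 3/2`; the print's further constraints on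
`κ` and `3/7 ≤ α` (Sect. 3) are not needed here (`0 < α < 1/2` suffices). (d) §4–§5 prove the two estimates that the derivation of (iv) uses; §7–§8 (v1.2) prove (A.10)–(A.11) themselves on
the full strips, «valid for γ → ∞» realised as `γ ≥ 1`, «δ > 0 small» as `0 < δ ≤ π/2`, constants explicit.

**v1.1: §§1–3 up to `hC_mul_sin_eq_A7` and §§4–6 byte-identical to v1.0; + `tsum_termA7C_eq_brace`,
`hC_mul_sin_eq_A7_brace` at the end of §3.  v1.2 (p12 gen 18): APPEND-ONLY over v1.1; + §7 ((A.10) on `𝒟`),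
§8 ((A.8) on `ℂ`, (A.11) on `{|Re θ̌| ≤ δ}`).  v1.3 (p12 gen 19): heartbeat headroom only — a scoped
`set_option maxHeartbeats 400000 in` before `lemma_iv` (its proof was measured at ≥ 90 % of the default budget by the
build-hygiene lane, 2026-08-22); every declaration byte-identical to v1.2.**

**Not claimed.** (A.10)/(A.11) for `γ < 1` or `δ > π/2`; the induction hypotheses (A₁)–(A₃) for `g_HK` beyond
holomorphy; anything about the Migdal recursion, Theorem 1, or lattice Yang–Mills.
-/

noncomputable section

open Real Filter Topology Set

namespace Literature.MathematicalPhysics.QuantumFieldTheory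

namespace MullerSchiemann1987

namespace HeatKernel

/-! ## §1 Bounds: `‖cos θ‖ ≤ e^{|Im θ|}`, `‖U_l(c)‖ ≤ (1 + 2‖c‖)^l`, summability of `(l+1)q^{(l+1)²}M^l` -/

section ChebyshevBounds

/-- `‖cos θ‖ ≤ e^{|Im θ|}` for complex `θ`. [folklore] -/
private theorem norm_cos_le_exp_abs_im (θ : ℂ) : ‖Complex.cos θ‖ ≤ Real.exp |θ.im| := by
  have h1 : ‖Complex.exp (θ * Complex.I)‖ ≤ Real.exp |θ.im| := by
    rw [Complex.norm_exp]
    refine Real.exp_le_exp.mpr ?_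
    simp only [Complex.mul_re, Complex.I_re, Complex.I_im, mul_zero, mul_one, zero_sub]
    exact neg_le_abs _
  have h2 : ‖Complex.exp (-θ * Complex.I)‖ ≤ Real.exp |θ.im| := by
    rw [Complex.norm_exp]
    refine Real.exp_le_exp.mpr ?_
    simp only [Complex.mul_re, Complex.neg_re, Complex.I_re, Complex.neg_im, Complex.I_im, mul_zero,
      mul_one, zero_sub, neg_neg]
    exact le_abs_self _
  have hcos : Complex.cos θ = (Complex.exp (θ * Complex.I) + Complex.exp (-θ * Complex.I)) / 2 := rfl
  rw [hcos, norm_div, Complex.norm_two]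
  have := norm_add_le (Complex.exp (θ * Complex.I)) (Complex.exp (-θ * Complex.I))
  linarith

/-- `‖U_l(c)‖ ≤ (1 + 2‖c‖)^l` for the Chebyshev polynomials of the second kind (from the recurrence
`U_{l+2} = 2X·U_{l+1} − U_l`). [folklore] -/
private theorem norm_chebyshevU_eval_le (c : ℂ) (l : ℕ) :
    ‖(Polynomial.Chebyshev.U ℂ l).eval c‖ ≤ (1 + 2 * ‖c‖) ^ l := by
  set M : ℝ := 1 + 2 * ‖c‖ with hM
  have hM1 : 1 ≤ M := by rw [hM]; linarith [norm_nonneg c]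
  induction l using Nat.twoStepInduction with
  | zero => simp
  | one =>
    simp only [Nat.cast_one, Polynomial.Chebyshev.U_one, Polynomial.eval_mul, Polynomial.eval_ofNat,
      Polynomial.eval_X, pow_one, norm_mul, Complex.norm_two]
    linarith [norm_nonneg c]
  | more l h0 h1 =>
    have hrec : Polynomial.Chebyshev.U ℂ ((l + 2 : ℕ) : ℤ) =
        2 * Polynomial.X * Polynomial.Chebyshev.U ℂ ((l + 1 : ℕ) : ℤ) - Polynomial.Chebyshev.U ℂ (l : ℤ) := by
      have := Polynomial.Chebyshev.U_add_two ℂ (l : ℤ)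
      push_cast at this ⊢
      exact this
    rw [hrec, Polynomial.eval_sub, Polynomial.eval_mul, Polynomial.eval_mul, Polynomial.eval_ofNat,
      Polynomial.eval_X]
    calc ‖2 * c * Polynomial.eval c (Polynomial.Chebyshev.U ℂ ((l + 1 : ℕ) : ℤ)) -
          Polynomial.eval c (Polynomial.Chebyshev.U ℂ (l : ℤ))‖
        ≤ ‖2 * c * Polynomial.eval c (Polynomial.Chebyshev.U ℂ ((l + 1 : ℕ) : ℤ))‖ +
          ‖Polynomial.eval c (Polynomial.Chebyshev.U ℂ (l : ℤ))‖ := norm_sub_le _ _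
      _ ≤ 2 * ‖c‖ * M ^ (l + 1) + M ^ l := by
          rw [norm_mul, norm_mul, Complex.norm_two]
          gcongr
      _ ≤ 2 * ‖c‖ * M ^ (l + 1) + M ^ (l + 1) := by
          have : M ^ l ≤ M ^ (l + 1) := pow_le_pow_right₀ hM1 (Nat.le_succ l)
          linarith
      _ = M ^ (l + 2) := by rw [hM]; ring

end ChebyshevBounds

section Coefficients

variable {q : ℝ}

/-- The coefficients `c_l = (l+1) q^{(l+1)²}` of (A.1) against a geometric weight `M^l` are summable
(`q < 1`; ratio test). [folklore] -/
private theorem summable_coef_mul_pow (hq0 : 0 < q) (hq1 : q < 1) {M : ℝ} (hM : 0 < M) :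
    Summable fun l : ℕ => ((l : ℝ) + 1) * q ^ ((l + 1) ^ 2) * M ^ l := by
  refine summable_of_ratio_norm_eventually_le (r := 1 / 2) (by norm_num) ?_
  have hq : Tendsto (fun n : ℕ => q ^ n) atTop (𝓝 0) := tendsto_pow_atTop_nhds_zero_of_lt_one hq0.le hq1
  have hev : ∀ᶠ n : ℕ in atTop, q ^ n < 1 / (4 * M) :=
    hq.eventually (gt_mem_nhds (by positivity))
  filter_upwards [hev] with l hl
  have hpos : 0 < ((l : ℝ) + 1) * q ^ ((l + 1) ^ 2) * M ^ l := by positivity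
  rw [Real.norm_of_nonneg (by positivity), Real.norm_of_nonneg hpos.le]
  have hexp : q ^ ((l + 1 + 1) ^ 2) = q ^ ((l + 1) ^ 2) * q ^ (2 * l + 3) := by
    rw [← pow_add]; congr 1; ring
  have hql : q ^ (2 * l + 3) ≤ q ^ l := pow_le_pow_of_le_one hq0.le hq1.le (by omega)
  have h2 : ((l : ℝ) + 1 + 1) ≤ 2 * ((l : ℝ) + 1) := by linarith [(Nat.cast_nonneg l : (0 : ℝ) ≤ l)]
  push_cast
  rw [hexp, pow_succ]
  have hA : 0 ≤ q ^ ((l + 1) ^ 2) := by positivity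
  have hB : 0 ≤ M ^ l := by positivity
  have hqM : q ^ (2 * l + 3) * M ≤ 1 / 4 := by
    calc q ^ (2 * l + 3) * M ≤ q ^ l * M := by gcongr
      _ ≤ 1 / (4 * M) * M := by gcongr
      _ = 1 / 4 := by field_simp
  calc ((l : ℝ) + 1 + 1) * (q ^ ((l + 1) ^ 2) * q ^ (2 * l + 3)) * (M ^ l * M)
      = ((l : ℝ) + 1 + 1) * (q ^ (2 * l + 3) * M) * (q ^ ((l + 1) ^ 2) * M ^ l) := by ring
    _ ≤ (2 * ((l : ℝ) + 1)) * (1 / 4) * (q ^ ((l + 1) ^ 2) * M ^ l) := by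
        gcongr
    _ = 1 / 2 * (((l : ℝ) + 1) * q ^ ((l + 1) ^ 2) * M ^ l) := by ring

end Coefficients

/-! ## §2 The entire function `h` of (A.1) on `ℂ` -/

section ComplexDef

variable {γ : ℝ}

/-- The coefficient `c_l = (l+1) q^{(l+1)²}`, `q = e^{−1/(4γ)}`, of the series (A.1)/(2.20). [cite: MullerSchiemann1987, Appendix (A.1) p.284] -/
def coefA1 (γ : ℝ) (l : ℕ) : ℝ := ((l : ℝ) + 1) * nome γ ^ ((l + 1) ^ 2)

/-- `c_l > 0`. [cite: MullerSchiemann1987, Appendix (A.1) p.284] -/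
theorem coefA1_pos (γ : ℝ) (l : ℕ) : 0 < coefA1 γ l := by
  unfold coefA1; exact mul_pos (by positivity) (pow_pos (nome_pos γ) _)

/-- The `l`-th term of (A.1) on `ℂ`: `c_l · U_l(cos θ)` (`U_l(cos θ) = sin((l+1)θ)/sin θ`, the character `χ_{l/2}`).
[cite: MullerSchiemann1987, Appendix (A.1) p.284; (2.20) p.265] -/
def termC (γ : ℝ) (l : ℕ) (θ : ℂ) : ℂ :=
  (coefA1 γ l : ℂ) * (Polynomial.Chebyshev.U ℂ (l : ℤ)).eval (Complex.cos θ)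

/-- **The Gibbs factor `h` of (A.1) as a function on `ℂ`**: `h(θ) = 𝒩 Σ_{l≥0} (l+1) e^{−(l+1)²/(4γ)} U_l(cos θ)`,
`U_l` the Chebyshev polynomial of the second kind (`U_l(cos θ) sin θ = sin (l+1)θ`), i.e. the series
`𝒩 Σ_{l≥1} l e^{−l²/(4γ)} sin lθ / sin θ` of (A.1) with the removable singularities at `θ ∈ πℤ` filled in — the
«analytic continuation» of `g_HK` to complex angles used in Sect. 3 and in the Appendix Lemma (iv).
[cite: MullerSchiemann1987, Appendix (A.1) p.284; (2.8), (2.20) p.265] -/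
def hC (γ : ℝ) (θ : ℂ) : ℂ := (normN γ : ℂ) * ∑' l : ℕ, termC γ l θ

/-- Termwise bound: `‖c_l U_l(cos θ)‖ ≤ c_l (1 + 2e^{Y})^l` on the strip `|Im θ| ≤ Y`. [folklore] -/
private theorem norm_termC_le {Y : ℝ} (l : ℕ) {θ : ℂ} (hθ : |θ.im| ≤ Y) :
    ‖termC γ l θ‖ ≤ coefA1 γ l * (1 + 2 * Real.exp Y) ^ l := by
  unfold termC
  rw [norm_mul, Complex.norm_real, Real.norm_of_nonneg (coefA1_pos γ l).le]
  refine mul_le_mul_of_nonneg_left ?_ (coefA1_pos γ l).le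
  refine (norm_chebyshevU_eval_le _ _).trans ?_
  gcongr
  exact (norm_cos_le_exp_abs_im θ).trans (Real.exp_le_exp.mpr hθ)

/-- The majorant `Σ c_l (1 + 2e^{Y})^l` converges (`γ > 0`). [folklore] -/
private theorem summable_coefA1_mul_pow (hγ : 0 < γ) (Y : ℝ) :
    Summable fun l : ℕ => coefA1 γ l * (1 + 2 * Real.exp Y) ^ l := by
  unfold coefA1
  exact summable_coef_mul_pow (nome_pos γ) (nome_lt_one hγ) (by positivity)

/-- The series (A.1) converges absolutely at every complex `θ`. [cite: MullerSchiemann1987, Appendix (A.1) p.284] -/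
theorem summable_termC (hγ : 0 < γ) (θ : ℂ) : Summable fun l : ℕ => termC γ l θ :=
  Summable.of_norm_bounded (summable_coefA1_mul_pow hγ |θ.im|) fun l => norm_termC_le l le_rfl

/-- Each term `c_l U_l(cos θ)` is entire. [folklore] -/
private theorem differentiable_termC (γ : ℝ) (l : ℕ) : Differentiable ℂ (termC γ l) := by
  unfold termC
  exact (differentiable_const _).mul
    ((Polynomial.Chebyshev.U ℂ (l : ℤ)).differentiable.comp Complex.differentiable_cos)

/-- The open strip `{|Im θ| < Y}`. [folklore] -/
private theorem isOpen_strip (Y : ℝ) : IsOpen {θ : ℂ | |θ.im| < Y} :=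
  isOpen_lt (continuous_abs.comp Complex.continuous_im) continuous_const

/-- (A.1) is differentiable on every strip `{|Im θ| < Y}` (locally uniform convergence). [cite: MullerSchiemann1987, Appendix p.285 L.16–17] -/
theorem differentiableOn_tsum_termC (hγ : 0 < γ) (Y : ℝ) :
    DifferentiableOn ℂ (fun θ => ∑' l : ℕ, termC γ l θ) {θ : ℂ | |θ.im| < Y} :=
  Complex.differentiableOn_tsum_of_summable_norm (summable_coefA1_mul_pow hγ Y)
    (fun l => (differentiable_termC γ l).differentiableOn) (isOpen_strip Y)
    (fun l _ hθ => norm_termC_le l (le_of_lt hθ))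

/-- **`h` is entire** («Both representations are explicitly holomorphic», p.285; (A₁) p.266 «entire holomorphic in z»).
[cite: MullerSchiemann1987, Appendix (A.8) p.285 L.16–17; (A₁) p.266] -/
theorem differentiable_hC (hγ : 0 < γ) : Differentiable ℂ (hC γ) := by
  intro θ
  have hmem : θ ∈ {w : ℂ | |w.im| < |θ.im| + 1} := by simp
  have hd := (differentiableOn_tsum_termC hγ (|θ.im| + 1)).differentiableAt ((isOpen_strip _).mem_nhds hmem)
  exact (differentiableAt_const _).mul hd

/-- `h` is continuous on `ℂ`. [cite: MullerSchiemann1987, (A₁) p.266] -/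
theorem continuous_hC (hγ : 0 < γ) : Continuous (hC γ) := (differentiable_hC hγ).continuous

/-- **(A.1) on `ℂ`**: `h(θ) · sin θ = 𝒩 Σ_{l≥0} (l+1) e^{−(l+1)²/(4γ)} sin (l+1)θ` for every complex `θ`.
[cite: MullerSchiemann1987, Appendix (A.1) p.284] -/
theorem hC_mul_sin (γ : ℝ) (θ : ℂ) :
    hC γ θ * Complex.sin θ = (normN γ : ℂ) * ∑' l : ℕ, (coefA1 γ l : ℂ) * Complex.sin (((l : ℂ) + 1) * θ) := by
  unfold hC
  rw [mul_assoc, ← tsum_mul_right]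
  congr 1
  refine tsum_congr fun l => ?_
  unfold termC
  rw [mul_assoc, Polynomial.Chebyshev.U_complex_cos]
  push_cast
  ring_nf

/-- For real `θ` the complex series (A.1) is the real one: `h(θ) sin θ` agrees with `MS87HeatKernelSU2.h_mul_sin`. [cite: MullerSchiemann1987, Appendix (A.1) p.284] -/
private theorem hC_mul_sin_ofReal (hγ : 0 < γ) (θ : ℝ) :
    hC γ θ * Complex.sin θ = ((h γ θ * Real.sin θ : ℝ) : ℂ) := by
  rw [hC_mul_sin, h_mul_sin hγ θ]
  push_cast
  congr 1
  refine tsum_congr fun l => ?_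
  unfold coefA1
  rw [nome_pow_sq γ (l + 1)]
  push_cast
  ring_nf

/-- **On the real axis `hC = h`** (the function of `MS87HeatKernelSU2`): both are continuous and they agree where
`sin θ ≠ 0`, a dense set. [cite: MullerSchiemann1987, Appendix (A.1) p.284] -/
theorem hC_ofReal (hγ : 0 < γ) (θ : ℝ) : hC γ θ = h γ θ := by
  -- the two continuous functions on ℝ
  have hf : Continuous fun t : ℝ => hC γ t := (continuous_hC hγ).comp Complex.continuous_ofReal
  have hg : Continuous fun t : ℝ => ((h γ t : ℝ) : ℂ) := by
    have : Continuous (h γ) := by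
      unfold h
      exact continuous_const.mul (continuous_hk (nome_pos γ) (nome_lt_one hγ))
    exact Complex.continuous_ofReal.comp this
  -- the dense set where `sin ≠ 0`
  have hdense : Dense {t : ℝ | Real.sin t ≠ 0} := by
    have hc : ({t : ℝ | Real.sin t ≠ 0}ᶜ).Countable := by
      have hsub : {t : ℝ | Real.sin t ≠ 0}ᶜ ⊆ Set.range (fun n : ℤ => (n : ℝ) * π) := by
        intro t ht
        simp only [Set.mem_compl_iff, Set.mem_setOf_eq, not_not] at ht
        obtain ⟨n, hn⟩ := Real.sin_eq_zero_iff.mp ht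
        exact ⟨n, hn⟩
      exact (Set.countable_range _).mono hsub
    have := hc.dense_compl ℝ
    rwa [compl_compl] at this
  have heq : Set.EqOn (fun t : ℝ => hC γ t) (fun t : ℝ => ((h γ t : ℝ) : ℂ)) {t : ℝ | Real.sin t ≠ 0} := by
    intro t ht
    have hs : (Complex.sin t) ≠ 0 := by
      rw [← Complex.ofReal_sin]; exact Complex.ofReal_ne_zero.mpr ht
    have h1 := hC_mul_sin_ofReal hγ t
    push_cast at h1
    exact mul_right_cancel₀ hs h1
  exact congrFun (Continuous.ext_on hdense hf hg heq) θ

/-- `h(0) = 1` on `ℂ`. [cite: MullerSchiemann1987, (2.1) p.263] -/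
theorem hC_zero (hγ : 0 < γ) : hC γ 0 = 1 := by
  have := hC_ofReal hγ 0
  rw [Complex.ofReal_zero] at this
  rw [this, h_zero hγ, Complex.ofReal_one]

/-- `h` is even on `ℂ`. [cite: MullerSchiemann1987, (2.3) p.263] -/
theorem hC_neg (γ : ℝ) (θ : ℂ) : hC γ (-θ) = hC γ θ := by
  unfold hC termC
  simp [Complex.cos_neg]

end ComplexDef

/-! ## §3 (A.7) on `ℂ`: `h(θ) sin θ = 𝒩′ e^{−γθ²} Σ_{n∈ℤ} (θ − 2πn) e^{4πγnθ − 4π²γn²}` for all complex `θ` -/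

section A7Complex

variable {γ : ℝ}

/-- `ϑ`-terms at imaginary arguments are real (as in `MS87HeatKernelSU2` §10, private there). [folklore] -/
private theorem jacobiTheta₂_term_I'' (n : ℤ) (y T : ℝ) :
    jacobiTheta₂_term n (y * Complex.I) (T * Complex.I) =
      ((Real.exp (-(2 * π * n * y + π * n ^ 2 * T)) : ℝ) : ℂ) := by
  rw [jacobiTheta₂_term, Complex.ofReal_exp]
  congr 1
  push_cast
  linear_combination (2 * ↑π * (n : ℂ) * (y : ℂ) + ↑π * (n : ℂ) ^ 2 * (T : ℂ)) * Complex.I_mul_I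

/-- The real series `Σₙ e^{−(2πny + πn²T)}` converges (`T > 0`). [folklore] -/
private theorem summable_exp_I'' (y : ℝ) {T : ℝ} (hT : 0 < T) :
    Summable fun n : ℤ => Real.exp (-(2 * π * n * y + π * n ^ 2 * T)) := by
  have hT' : 0 < (T * Complex.I : ℂ).im := by simpa using hT
  have h := (hasSum_jacobiTheta₂_term (y * Complex.I) hT').summable
  simp_rw [jacobiTheta₂_term_I''] at h
  exact Complex.summable_ofReal.mp h

/-- The real series `Σₙ n e^{−(2πny + πn²T)}` converges (`T > 0`). [folklore] -/
private theorem summable_int_mul_exp_I'' (y : ℝ) {T : ℝ} (hT : 0 < T) :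
    Summable fun n : ℤ => (n : ℝ) * Real.exp (-(2 * π * n * y + π * n ^ 2 * T)) := by
  have hT' : 0 < (T * Complex.I : ℂ).im := by simpa using hT
  have h := (hasSum_jacobiTheta₂'_term (y * Complex.I) hT').summable
  have h' : Summable fun n : ℤ => (2 * π * Complex.I) *
      ((((n : ℝ) * Real.exp (-(2 * π * n * y + π * n ^ 2 * T))) : ℝ) : ℂ) := by
    refine h.congr fun n => ?_
    rw [jacobiTheta₂'_term, jacobiTheta₂_term_I'']
    push_cast
    ring
  have h2 : (2 * π * Complex.I : ℂ) ≠ 0 :=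
    mul_ne_zero (mul_ne_zero two_ne_zero (Complex.ofReal_ne_zero.mpr Real.pi_ne_zero)) Complex.I_ne_zero
  exact Complex.summable_ofReal.mp ((summable_mul_left_iff h2).mp h')

/-- The Gaussian weights `E_c(n) = e^{cn − 4π²γn²}` are summable over `ℤ` for every real `c`. [folklore] -/
private theorem summable_exp_lin_sub_sq (hγ : 0 < γ) (c : ℝ) :
    Summable fun n : ℤ => Real.exp (c * n - 4 * π ^ 2 * γ * n ^ 2) := by
  have h := summable_exp_I'' (-(c / (2 * π))) (by positivity : 0 < 4 * π * γ)
  refine h.congr fun n => ?_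
  congr 1
  field_simp
  ring

/-- `|n| e^{cn − 4π²γn²}` is summable over `ℤ`. [folklore] -/
private theorem summable_abs_mul_exp_lin_sub_sq (hγ : 0 < γ) (c : ℝ) :
    Summable fun n : ℤ => |(n : ℝ)| * Real.exp (c * n - 4 * π ^ 2 * γ * n ^ 2) := by
  have h := (summable_int_mul_exp_I'' (-(c / (2 * π))) (by positivity : 0 < 4 * π * γ)).norm
  refine h.congr fun n => ?_
  rw [norm_mul, Real.norm_eq_abs, Real.norm_of_nonneg (Real.exp_pos _).le]
  congr 1
  congr 1
  field_simp
  ring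

/-- The `n`-th term of (A.7) on `ℂ` (squares expanded): `(θ − 2πn) e^{4πγnθ − 4π²γn²}`.
[cite: MullerSchiemann1987, Appendix (A.7) p.285] -/
def termA7C (γ : ℝ) (n : ℤ) (θ : ℂ) : ℂ :=
  (θ - 2 * π * n) * Complex.exp (4 * π * γ * n * θ - 4 * π ^ 2 * γ * n ^ 2)

/-- Each term of (A.7) is entire. [folklore] -/
private theorem differentiable_termA7C (γ : ℝ) (n : ℤ) : Differentiable ℂ (termA7C γ n) := by
  unfold termA7C
  fun_prop

/-- The majorant of (A.7) on the rectangle `{|Re θ| ≤ X, |Im θ| ≤ Y}`. [folklore] -/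
private def majA7 (γ X Y : ℝ) (n : ℤ) : ℝ :=
  (X + Y) * (Real.exp (4 * π * γ * X * n - 4 * π ^ 2 * γ * n ^ 2)
      + Real.exp (-(4 * π * γ * X) * n - 4 * π ^ 2 * γ * n ^ 2))
    + 2 * π * (|(n : ℝ)| * Real.exp (4 * π * γ * X * n - 4 * π ^ 2 * γ * n ^ 2)
      + |(n : ℝ)| * Real.exp (-(4 * π * γ * X) * n - 4 * π ^ 2 * γ * n ^ 2))

/-- The majorant is summable over `ℤ`. [folklore] -/
private theorem summable_majA7 (hγ : 0 < γ) (X Y : ℝ) : Summable (majA7 γ X Y) := by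
  unfold majA7
  exact (((summable_exp_lin_sub_sq hγ _).add (summable_exp_lin_sub_sq hγ _)).mul_left _).add
    (((summable_abs_mul_exp_lin_sub_sq hγ _).add (summable_abs_mul_exp_lin_sub_sq hγ _)).mul_left _)

/-- Termwise bound on the rectangle: `‖(θ − 2πn)e^{4πγnθ − 4π²γn²}‖ ≤ (X + Y + 2π|n|)(E₊(n) + E₋(n))`. [folklore] -/
private theorem norm_termA7C_le (hγ : 0 < γ) {X Y : ℝ} (n : ℤ) {θ : ℂ} (hre : |θ.re| ≤ X) (him : |θ.im| ≤ Y) :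
    ‖termA7C γ n θ‖ ≤ majA7 γ X Y n := by
  have hπ : 0 < π := Real.pi_pos
  unfold termA7C majA7
  rw [norm_mul, Complex.norm_exp]
  -- the real part of the exponent
  have hre_exp : (4 * (π : ℂ) * γ * n * θ - 4 * π ^ 2 * γ * n ^ 2).re
      = 4 * π * γ * n * θ.re - 4 * π ^ 2 * γ * n ^ 2 := by
    simp [Complex.mul_re, Complex.sub_re, pow_two]
  rw [hre_exp]
  -- |θ − 2πn| ≤ X + Y + 2π|n|
  have h1 : ‖θ - 2 * (π : ℂ) * n‖ ≤ X + Y + 2 * π * |(n : ℝ)| := by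
    calc ‖θ - 2 * (π : ℂ) * n‖ ≤ ‖θ‖ + ‖2 * (π : ℂ) * n‖ := norm_sub_le _ _
      _ ≤ (|θ.re| + |θ.im|) + 2 * π * |(n : ℝ)| := by
          gcongr
          · exact Complex.norm_le_abs_re_add_abs_im θ
          · rw [norm_mul, norm_mul, Complex.norm_two, Complex.norm_real, Real.norm_of_nonneg hπ.le,
              Complex.norm_intCast]
      _ ≤ X + Y + 2 * π * |(n : ℝ)| := by linarith
  -- e^{4πγ n re θ − 4π²γn²} ≤ E₊(n) + E₋(n)
  set Ep := Real.exp (4 * π * γ * X * n - 4 * π ^ 2 * γ * n ^ 2) with hEp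
  set Em := Real.exp (-(4 * π * γ * X) * n - 4 * π ^ 2 * γ * n ^ 2) with hEm
  have hEp0 : 0 < Ep := Real.exp_pos _
  have hEm0 : 0 < Em := Real.exp_pos _
  have h2 : Real.exp (4 * π * γ * n * θ.re - 4 * π ^ 2 * γ * n ^ 2) ≤ Ep + Em := by
    have hnx : (n : ℝ) * θ.re ≤ |(n : ℝ)| * X := by
      calc (n : ℝ) * θ.re ≤ |(n : ℝ) * θ.re| := le_abs_self _
        _ = |(n : ℝ)| * |θ.re| := abs_mul _ _
        _ ≤ |(n : ℝ)| * X := by gcongr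
    have hc : 0 ≤ 4 * π * γ := by positivity
    have hnx' := mul_le_mul_of_nonneg_left hnx hc
    rcases le_or_gt 0 (n : ℝ) with hn | hn
    · have : Real.exp (4 * π * γ * n * θ.re - 4 * π ^ 2 * γ * n ^ 2) ≤ Ep := by
        rw [hEp]; refine Real.exp_le_exp.mpr ?_
        rw [abs_of_nonneg hn] at hnx'
        linarith
      linarith
    · have : Real.exp (4 * π * γ * n * θ.re - 4 * π ^ 2 * γ * n ^ 2) ≤ Em := by
        rw [hEm]; refine Real.exp_le_exp.mpr ?_
        rw [abs_of_neg hn] at hnx'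
        linarith
      linarith
  have hX : 0 ≤ X := (abs_nonneg _).trans hre
  have hY : 0 ≤ Y := (abs_nonneg _).trans him
  have hS : 0 ≤ X + Y + 2 * π * |(n : ℝ)| := by positivity
  calc ‖θ - 2 * (π : ℂ) * n‖ * Real.exp (4 * π * γ * n * θ.re - 4 * π ^ 2 * γ * n ^ 2)
      ≤ (X + Y + 2 * π * |(n : ℝ)|) * (Ep + Em) :=
        mul_le_mul h1 h2 (Real.exp_pos _).le hS
    _ = (X + Y) * (Ep + Em) + 2 * π * (|(n : ℝ)| * Ep + |(n : ℝ)| * Em) := by ring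

/-- The exact size of one term: `‖(θ − 2πn)e^{4πγnθ − 4π²γn²}‖ ≤ (|Re θ| + |Im θ| + 2π|n|) e^{4πγn Re θ − 4π²γn²}`. [folklore] -/
private theorem norm_termA7C_le_explicit (γ : ℝ) (n : ℤ) (θ : ℂ) :
    ‖termA7C γ n θ‖ ≤ (|θ.re| + |θ.im| + 2 * π * |(n : ℝ)|) * Real.exp (4 * π * γ * n * θ.re - 4 * π ^ 2 * γ * n ^ 2) := by
  have hπ : 0 < π := Real.pi_pos
  unfold termA7C
  rw [norm_mul, Complex.norm_exp]
  have hre_exp : (4 * (π : ℂ) * γ * n * θ - 4 * π ^ 2 * γ * n ^ 2).re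
      = 4 * π * γ * n * θ.re - 4 * π ^ 2 * γ * n ^ 2 := by
    simp [Complex.mul_re, Complex.sub_re, pow_two]
  rw [hre_exp]
  refine mul_le_mul_of_nonneg_right ?_ (Real.exp_pos _).le
  calc ‖θ - 2 * (π : ℂ) * n‖ ≤ ‖θ‖ + ‖2 * (π : ℂ) * n‖ := norm_sub_le _ _
    _ ≤ (|θ.re| + |θ.im|) + 2 * π * |(n : ℝ)| := by
        gcongr
        · exact Complex.norm_le_abs_re_add_abs_im θ
        · rw [norm_mul, norm_mul, Complex.norm_two, Complex.norm_real, Real.norm_of_nonneg hπ.le,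
            Complex.norm_intCast]

/-- The open rectangle `{|Re θ| < X, |Im θ| < Y}`. [folklore] -/
private theorem isOpen_rect (X Y : ℝ) : IsOpen {θ : ℂ | |θ.re| < X ∧ |θ.im| < Y} :=
  (isOpen_lt (continuous_abs.comp Complex.continuous_re) continuous_const).inter
    (isOpen_lt (continuous_abs.comp Complex.continuous_im) continuous_const)

/-- The series of (A.7) converges absolutely at every complex `θ`. [cite: MullerSchiemann1987, Appendix (A.7) p.285] -/
theorem summable_termA7C (hγ : 0 < γ) (θ : ℂ) : Summable fun n : ℤ => termA7C γ n θ :=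
  Summable.of_norm_bounded (summable_majA7 hγ |θ.re| |θ.im|) fun n => norm_termA7C_le hγ n le_rfl le_rfl

/-- The series of (A.7) is entire («explicitly holomorphic»). [cite: MullerSchiemann1987, Appendix (A.8) p.285 L.16–17] -/
theorem differentiable_tsum_termA7C (hγ : 0 < γ) : Differentiable ℂ fun θ => ∑' n : ℤ, termA7C γ n θ := by
  intro θ
  have hmem : θ ∈ {w : ℂ | |w.re| < |θ.re| + 1 ∧ |w.im| < |θ.im| + 1} := by simp
  have hd : DifferentiableOn ℂ (fun w => ∑' n : ℤ, termA7C γ n w)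
      {w : ℂ | |w.re| < |θ.re| + 1 ∧ |w.im| < |θ.im| + 1} :=
    Complex.differentiableOn_tsum_of_summable_norm (summable_majA7 hγ (|θ.re| + 1) (|θ.im| + 1))
      (fun n => (differentiable_termA7C γ n).differentiableOn) (isOpen_rect _ _)
      (fun n _ hw => norm_termA7C_le hγ n (le_of_lt hw.1) (le_of_lt hw.2))
  exact hd.differentiableAt ((isOpen_rect _ _).mem_nhds hmem)

/-- Two entire functions that agree on `ℝ` agree on `ℂ` (identity theorem). [folklore] -/
private theorem eq_of_eqOn_real {f g : ℂ → ℂ} (hf : Differentiable ℂ f) (hg : Differentiable ℂ g)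
    (hfg : ∀ x : ℝ, f x = g x) : f = g := by
  refine AnalyticOnNhd.eq_of_frequently_eq (z₀ := 0) (Complex.analyticOnNhd_univ_iff_differentiable.mpr hf)
    (Complex.analyticOnNhd_univ_iff_differentiable.mpr hg) ?_
  refine Filter.frequently_iff.mpr fun {U} hU => ?_
  obtain ⟨ε, hε, hsub⟩ := Metric.mem_nhdsWithin_iff.mp hU
  refine ⟨((ε / 2 : ℝ) : ℂ), hsub ⟨?_, ?_⟩, hfg _⟩
  · rw [Metric.mem_ball, dist_zero_right, Complex.norm_real, Real.norm_of_nonneg (by positivity)]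
    linarith
  · simp only [Set.mem_compl_iff, Set.mem_singleton_iff, Complex.ofReal_eq_zero]
    exact (by positivity : (0 : ℝ) < ε / 2).ne'

/-- `e^{−γ(θ−2πn)²} = e^{−γθ²} e^{4πγnθ − 4π²γn²}` (real). [folklore] -/
private theorem exp_periodic_eq'' (γ θ : ℝ) (n : ℤ) :
    Real.exp (-(γ * (θ - 2 * π * n) ^ 2)) =
      Real.exp (-(γ * θ ^ 2)) * Real.exp (4 * π * γ * n * θ - 4 * π ^ 2 * γ * n ^ 2) := by
  rw [← Real.exp_add]
  congr 1
  ring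

/-- The real (A.7) of `MS87HeatKernelSU2` with the squares expanded:
`h(θ) sin θ = 𝒩′ e^{−γθ²} Σ_{n∈ℤ} (θ − 2πn) e^{4πγnθ − 4π²γn²}`, `θ ∈ ℝ`. [cite: MullerSchiemann1987, Appendix (A.7) p.285] -/
theorem h_mul_sin_eq_A7_expanded (hγ : 0 < γ) (θ : ℝ) :
    h γ θ * Real.sin θ = normN' γ * Real.exp (-(γ * θ ^ 2)) *
      ∑' n : ℤ, (θ - 2 * π * n) * Real.exp (4 * π * γ * n * θ - 4 * π ^ 2 * γ * n ^ 2) := by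
  rw [h_mul_sin_eq_periodicGaussian hγ, mul_assoc]
  congr 1
  rw [← tsum_mul_left]
  refine tsum_congr fun n => ?_
  rw [exp_periodic_eq'']
  ring

/-- **(A.7) ON `ℂ`**: for every complex `θ`,
`h(θ) · sin θ = 𝒩′ e^{−γθ²} Σ_{n∈ℤ} (θ − 2πn) e^{4πγnθ − 4π²γn²}`
(`= 𝒩′ θ e^{−γθ²}{1 + 2Σ_{n≥1}[cosh 4πγnθ − 2πnθ⁻¹ sinh 4πγnθ]e^{−4π²γn²}}` of the print) — the theta-inversion
representation of the Appendix holds for complex angles: both sides are entire and agree on `ℝ`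
(`MS87HeatKernelSU2.h_mul_sin_eq_periodicGaussian`), hence everywhere by the identity theorem.
[cite: MullerSchiemann1987, Appendix (A.7)–(A.8) p.285] -/
theorem hC_mul_sin_eq_A7 (hγ : 0 < γ) (θ : ℂ) :
    hC γ θ * Complex.sin θ =
      (normN' γ : ℂ) * Complex.exp (-(γ * θ ^ 2)) * ∑' n : ℤ, termA7C γ n θ := by
  have hf : Differentiable ℂ fun w => hC γ w * Complex.sin w :=
    (differentiable_hC hγ).mul Complex.differentiable_sin
  have hg : Differentiable ℂ fun w : ℂ =>
      (normN' γ : ℂ) * Complex.exp (-(γ * w ^ 2)) * ∑' n : ℤ, termA7C γ n w := by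
    have h1 : Differentiable ℂ fun w : ℂ => (normN' γ : ℂ) * Complex.exp (-(γ * w ^ 2)) := by fun_prop
    exact h1.mul (differentiable_tsum_termA7C hγ)
  have key := eq_of_eqOn_real hf hg fun x => ?_
  · exact congrFun key θ
  -- agreement on the real axis
  rw [hC_ofReal hγ, ← Complex.ofReal_sin, ← Complex.ofReal_mul, h_mul_sin_eq_A7_expanded hγ x]
  push_cast
  rfl

/-- Pairing `n + 1 ↔ −(n + 1)` in the series of (A.7) on `ℂ`:
`Σ_{n∈ℤ} (θ − 2πn)e^{4πγnθ − 4π²γn²} = θ + 2Σ_{n≥0}[θ cosh(4πγ(n+1)θ) − 2π(n+1) sinh(4πγ(n+1)θ)]e^{−4π²γ(n+1)²}` — the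
brace of the printed (A.7) `{1 + 2Σ_{n=1}^∞ [cosh 4πγnθ − 2πnθ⁻¹ sinh 4πnγθ] exp(−4π²γn²)}` multiplied by `θ`.
[cite: MullerSchiemann1987, Appendix (A.7) p.285] -/
theorem tsum_termA7C_eq_brace (hγ : 0 < γ) (θ : ℂ) :
    ∑' n : ℤ, termA7C γ n θ = θ + 2 * ∑' n : ℕ, (θ * Complex.cosh (4 * π * γ * ((n : ℂ) + 1) * θ)
      - 2 * π * ((n : ℂ) + 1) * Complex.sinh (4 * π * γ * ((n : ℂ) + 1) * θ))
        * Complex.exp (-(4 * π ^ 2 * γ * ((n : ℂ) + 1) ^ 2)) := by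
  set g : ℤ → ℂ := fun n => termA7C γ n θ with hg
  have hgs : Summable g := summable_termA7C hγ θ
  have h1 : Summable fun l : ℕ => g ((l : ℤ) + 1) :=
    hgs.comp_injective (i := fun l : ℕ => (l : ℤ) + 1) fun a b hab => by simpa using hab
  have h2 : Summable fun l : ℕ => g (-((l : ℤ) + 1)) :=
    hgs.comp_injective (i := fun l : ℕ => -((l : ℤ) + 1)) fun a b hab => by simpa using hab
  have hg0 : g 0 = θ := by simp [hg, termA7C]
  have hpair : ∀ l : ℕ, g ((l : ℤ) + 1) + g (-((l : ℤ) + 1)) =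
      2 * ((θ * Complex.cosh (4 * π * γ * ((l : ℂ) + 1) * θ)
        - 2 * π * ((l : ℂ) + 1) * Complex.sinh (4 * π * γ * ((l : ℂ) + 1) * θ))
        * Complex.exp (-(4 * π ^ 2 * γ * ((l : ℂ) + 1) ^ 2))) := by
    intro l
    simp only [hg, termA7C, Complex.cosh, Complex.sinh]
    push_cast
    have e1 : Complex.exp (4 * π * γ * ((l : ℂ) + 1) * θ - 4 * π ^ 2 * γ * ((l : ℂ) + 1) ^ 2)
        = Complex.exp (4 * π * γ * ((l : ℂ) + 1) * θ) * Complex.exp (-(4 * π ^ 2 * γ * ((l : ℂ) + 1) ^ 2)) := by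
      rw [← Complex.exp_add, sub_eq_add_neg]
    have e2 : Complex.exp (4 * π * γ * (-((l : ℂ) + 1)) * θ - 4 * π ^ 2 * γ * (-((l : ℂ) + 1)) ^ 2)
        = Complex.exp (-(4 * π * γ * ((l : ℂ) + 1) * θ)) * Complex.exp (-(4 * π ^ 2 * γ * ((l : ℂ) + 1) ^ 2)) := by
      have : 4 * (π : ℂ) * γ * (-((l : ℂ) + 1)) * θ - 4 * π ^ 2 * γ * (-((l : ℂ) + 1)) ^ 2
          = -(4 * π * γ * ((l : ℂ) + 1) * θ) + -(4 * π ^ 2 * γ * ((l : ℂ) + 1) ^ 2) := by ring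
      rw [this, Complex.exp_add]
    rw [e1, e2]
    ring
  have hsplit := tsum_of_add_one_of_neg_add_one h1 h2
  have hmm : (∑' l : ℕ, g ((l : ℤ) + 1)) + ∑' l : ℕ, g (-((l : ℤ) + 1)) =
      2 * ∑' n : ℕ, (θ * Complex.cosh (4 * π * γ * ((n : ℂ) + 1) * θ)
        - 2 * π * ((n : ℂ) + 1) * Complex.sinh (4 * π * γ * ((n : ℂ) + 1) * θ))
        * Complex.exp (-(4 * π ^ 2 * γ * ((n : ℂ) + 1) ^ 2)) := by
    rw [← h1.tsum_add h2, tsum_congr hpair, tsum_mul_left]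
  rw [hsplit, hg0, add_right_comm, hmm]
  ring

/-- **(A.7) on `ℂ` in the printed form**: for every complex `θ`,
`h(θ) sin θ = 𝒩′ e^{−γθ²} {θ + 2Σ_{n≥1} [θ cosh 4πγnθ − 2πn sinh 4πγnθ] e^{−4π²γn²}}`
(the print's `𝒩′ θ e^{−γθ²}{1 + 2Σ_{n=1}^∞ [cosh 4πγnθ − 2πnθ⁻¹ sinh 4πnγθ] exp(−4π²γn²)}` times `sin θ`, without the
division by `θ`). [cite: MullerSchiemann1987, Appendix (A.7) p.285] -/
theorem hC_mul_sin_eq_A7_brace (hγ : 0 < γ) (θ : ℂ) :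
    hC γ θ * Complex.sin θ = (normN' γ : ℂ) * Complex.exp (-(γ * θ ^ 2)) *
      (θ + 2 * ∑' n : ℕ, (θ * Complex.cosh (4 * π * γ * ((n : ℂ) + 1) * θ)
        - 2 * π * ((n : ℂ) + 1) * Complex.sinh (4 * π * γ * ((n : ℂ) + 1) * θ))
          * Complex.exp (-(4 * π ^ 2 * γ * ((n : ℂ) + 1) ^ 2))) := by
  rw [hC_mul_sin_eq_A7 hγ, tsum_termA7C_eq_brace hγ]

end A7Complex

/-! ## §4 The large-`γ` product bound on the strip: `‖h(θ) sin θ‖ ≤ 2K e^{γ(Im θ)² − γ(Re θ)²}` (`|Re θ| ≤ π`, `|Im θ| ≤ 1`, `γ ≥ 1`) -/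

section ProductBound

variable {γ : ℝ}

/-- `h` is `2π`-periodic on `ℂ`. [cite: MullerSchiemann1987, (2.20) p.265] -/
theorem hC_add_two_pi (γ : ℝ) (θ : ℂ) : hC γ (θ + 2 * π) = hC γ θ := by
  unfold hC termC
  simp [Complex.cos_add_two_pi]

/-- `h` is `2π`-periodic on `ℂ`. [cite: MullerSchiemann1987, (2.20) p.265] -/
theorem hC_sub_two_pi (γ : ℝ) (θ : ℂ) : hC γ (θ - 2 * π) = hC γ θ := by
  have := hC_add_two_pi γ (θ - 2 * π)
  rw [sub_add_cancel] at this
  exact this.symm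

/-- The constant `K = e^{2π²} Σ_{n∈ℤ} (π + 1 + 2π|n|) e^{−2π²n²}` of the product bound (an explicit form of the `𝒪(1)` of (A.10)). [cite: MullerSchiemann1987, Appendix (A.10) p.285] -/
def KP : ℝ := Real.exp (2 * π ^ 2) * ∑' n : ℤ, (π + 1 + 2 * π * |(n : ℝ)|) * Real.exp (-(2 * π ^ 2 * (n : ℝ) ^ 2))

/-- The series of `K` is summable. [folklore] -/
private theorem summable_KP_term :
    Summable fun n : ℤ => (π + 1 + 2 * π * |(n : ℝ)|) * Real.exp (-(2 * π ^ 2 * (n : ℝ) ^ 2)) := by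
  have h1 := summable_exp_lin_sub_sq (by norm_num : (0 : ℝ) < 1 / 2) 0
  have h2 := summable_abs_mul_exp_lin_sub_sq (by norm_num : (0 : ℝ) < 1 / 2) 0
  have hE : ∀ n : ℤ, Real.exp (0 * (n : ℝ) - 4 * π ^ 2 * (1 / 2) * (n : ℝ) ^ 2) = Real.exp (-(2 * π ^ 2 * (n : ℝ) ^ 2)) := by
    intro n; congr 1; ring
  simp_rw [hE] at h1 h2
  refine ((h1.mul_left (π + 1)).add (h2.mul_left (2 * π))).congr fun n => ?_
  ring

/-- `K > 0`. [cite: MullerSchiemann1987, Appendix (A.10) p.285] -/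
theorem KP_pos : 0 < KP := by
  unfold KP
  refine mul_pos (Real.exp_pos _) ?_
  have hπ : 0 < π := Real.pi_pos
  have h0 : ∀ n : ℤ, 0 ≤ (π + 1 + 2 * π * |(n : ℝ)|) * Real.exp (-(2 * π ^ 2 * (n : ℝ) ^ 2)) :=
    fun n => by positivity
  have := summable_KP_term.tsum_pos h0 0 (by norm_num; positivity)
  exact this

/-- For `|x| ≤ π` and an integer `n`: `n(πn − x) ≥ π|n|(|n| − 1) ≥ (n² − 1)/2 · π`, hence the exponent bound
`4πγn x − 4π²γn² ≤ 2π² − 2π²n²` for `γ ≥ 1`. [folklore] -/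
private theorem exponent_le (hγ : 1 ≤ γ) (n : ℤ) {x : ℝ} (hx : |x| ≤ π) :
    4 * π * γ * n * x - 4 * π ^ 2 * γ * n ^ 2 ≤ 2 * π ^ 2 - 2 * π ^ 2 * (n : ℝ) ^ 2 := by
  have hπ : 0 < π := Real.pi_pos
  -- n x ≤ |n| π
  have h1 : (n : ℝ) * x ≤ |(n : ℝ)| * π := by
    calc (n : ℝ) * x ≤ |(n : ℝ) * x| := le_abs_self _
      _ = |(n : ℝ)| * |x| := abs_mul _ _
      _ ≤ |(n : ℝ)| * π := by gcongr
  have hn2 : (n : ℝ) ^ 2 = |(n : ℝ)| ^ 2 := (sq_abs _).symm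
  -- |n|(|n|-1) ≥ 0 for integers, and ≥ (n²-1)/2
  have hint : (0 : ℝ) ≤ |(n : ℝ)| * (|(n : ℝ)| - 1) := by
    rcases eq_or_ne n 0 with h | h
    · simp [h]
    · have : (1 : ℝ) ≤ |(n : ℝ)| := by
        rw [← Int.cast_abs]; exact_mod_cast Int.one_le_abs h
      nlinarith
  -- main
  have hγ0 : 0 ≤ γ - 1 := by linarith
  have hA : 4 * π * γ * n * x - 4 * π ^ 2 * γ * n ^ 2 ≤ -(4 * π ^ 2 * γ * (|(n : ℝ)| * (|(n : ℝ)| - 1))) := by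
    rw [hn2]
    have := mul_le_mul_of_nonneg_left h1 (by positivity : (0 : ℝ) ≤ 4 * π * γ)
    nlinarith
  have hB : -(4 * π ^ 2 * γ * (|(n : ℝ)| * (|(n : ℝ)| - 1))) ≤ -(4 * π ^ 2 * (|(n : ℝ)| * (|(n : ℝ)| - 1))) := by
    have := mul_le_mul_of_nonneg_right hγ (mul_nonneg (by positivity : (0:ℝ) ≤ 4 * π ^ 2) hint)
    nlinarith
  have hC : -(4 * π ^ 2 * (|(n : ℝ)| * (|(n : ℝ)| - 1))) ≤ 2 * π ^ 2 - 2 * π ^ 2 * (n : ℝ) ^ 2 := by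
    rw [hn2]
    nlinarith [sq_nonneg (|(n : ℝ)| - 1), hπ]
  linarith

/-- Termwise, on `|Re θ| ≤ π`, `|Im θ| ≤ 1`, `γ ≥ 1`: `‖(θ − 2πn)e^{…}‖ ≤ (π + 1 + 2π|n|)e^{2π²}e^{−2π²n²}`. [folklore] -/
private theorem norm_termA7C_le_KPterm (hγ : 1 ≤ γ) (n : ℤ) {θ : ℂ} (hre : |θ.re| ≤ π) (him : |θ.im| ≤ 1) :
    ‖termA7C γ n θ‖ ≤ Real.exp (2 * π ^ 2) * ((π + 1 + 2 * π * |(n : ℝ)|) * Real.exp (-(2 * π ^ 2 * (n : ℝ) ^ 2))) := by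
  have hπ : 0 < π := Real.pi_pos
  refine (norm_termA7C_le_explicit γ n θ).trans ?_
  have h1 : |θ.re| + |θ.im| + 2 * π * |(n : ℝ)| ≤ π + 1 + 2 * π * |(n : ℝ)| := by linarith
  have h2 : Real.exp (4 * π * γ * n * θ.re - 4 * π ^ 2 * γ * n ^ 2) ≤
      Real.exp (2 * π ^ 2) * Real.exp (-(2 * π ^ 2 * (n : ℝ) ^ 2)) := by
    rw [← Real.exp_add]
    exact Real.exp_le_exp.mpr (by linarith [exponent_le hγ n hre])
  calc (|θ.re| + |θ.im| + 2 * π * |(n : ℝ)|) * Real.exp (4 * π * γ * n * θ.re - 4 * π ^ 2 * γ * n ^ 2)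
      ≤ (π + 1 + 2 * π * |(n : ℝ)|) * (Real.exp (2 * π ^ 2) * Real.exp (-(2 * π ^ 2 * (n : ℝ) ^ 2))) := by
        gcongr
    _ = _ := by ring

/-- `‖Σ_{n∈ℤ} (θ − 2πn)e^{4πγnθ − 4π²γn²}‖ ≤ K` on `|Re θ| ≤ π`, `|Im θ| ≤ 1`, for `γ ≥ 1`. [cite: MullerSchiemann1987, Appendix (A.7), (A.10) p.285] -/
theorem norm_tsum_termA7C_le (hγ : 1 ≤ γ) {θ : ℂ} (hre : |θ.re| ≤ π) (him : |θ.im| ≤ 1) :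
    ‖∑' n : ℤ, termA7C γ n θ‖ ≤ KP := by
  unfold KP
  have hs := (summable_KP_term.mul_left (Real.exp (2 * π ^ 2))).hasSum
  rw [← tsum_mul_left]
  exact tsum_of_norm_bounded hs fun n => norm_termA7C_le_KPterm hγ n hre him

/-- `‖e^{−γθ²}‖ = e^{γ(Im θ)² − γ(Re θ)²}`. [folklore] -/
private theorem norm_cexp_neg_sq (γ : ℝ) (θ : ℂ) :
    ‖Complex.exp (-(γ * θ ^ 2))‖ = Real.exp (γ * θ.im ^ 2 - γ * θ.re ^ 2) := by
  rw [Complex.norm_exp]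
  congr 1
  simp [Complex.mul_re, pow_two]
  ring

/-- **The product bound** (from (A.7) on `ℂ` and (A.9) `𝒩′ ≤ 2`): for `γ ≥ 1`, `|Re θ| ≤ π`, `|Im θ| ≤ 1`,
`‖h(θ) sin θ‖ ≤ 2K e^{γ(Im θ)² − γ(Re θ)²}` — the common core of (A.10) and (A.11) with the modulus of
`e^{−γθ²}`, `|e^{−γθ²}| = e^{−γ Re θ²}`, made explicit. [cite: MullerSchiemann1987, Appendix (A.7)–(A.11) p.285] -/
theorem norm_hC_mul_sin_le (hγ : 1 ≤ γ) {θ : ℂ} (hre : |θ.re| ≤ π) (him : |θ.im| ≤ 1) :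
    ‖hC γ θ * Complex.sin θ‖ ≤ 2 * KP * Real.exp (γ * θ.im ^ 2 - γ * θ.re ^ 2) := by
  have hγ0 : 0 < γ := by linarith
  rw [hC_mul_sin_eq_A7 hγ0, norm_mul, norm_mul, Complex.norm_real,
    Real.norm_of_nonneg (by linarith [one_le_normN' (show 1 / (8 * π ^ 2) ≤ γ by
      have hπ : (3:ℝ) < π := Real.pi_gt_three
      have : 1 / (8 * π ^ 2) ≤ 1 := by
        rw [div_le_one (by positivity)]; nlinarith
      linarith)]), norm_cexp_neg_sq]
  have h1 := normN'_le_two hγ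
  have h2 := norm_tsum_termA7C_le hγ hre him
  have h0 : 0 ≤ normN' γ := by
    linarith [one_le_normN' (show 1 / (8 * π ^ 2) ≤ γ by
      have hπ : (3:ℝ) < π := Real.pi_gt_three
      have : 1 / (8 * π ^ 2) ≤ 1 := by
        rw [div_le_one (by positivity)]; nlinarith
      linarith)]
  have hE : 0 ≤ Real.exp (γ * θ.im ^ 2 - γ * θ.re ^ 2) := (Real.exp_pos _).le
  calc normN' γ * Real.exp (γ * θ.im ^ 2 - γ * θ.re ^ 2) * ‖∑' n : ℤ, termA7C γ n θ‖
      ≤ 2 * Real.exp (γ * θ.im ^ 2 - γ * θ.re ^ 2) * KP := by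
        gcongr
    _ = 2 * KP * Real.exp (γ * θ.im ^ 2 - γ * θ.re ^ 2) := by ring

end ProductBound

/-! ## §5 Lower bounds for `|sin θ|` and the maximum principle near `θ = ±π` -/

section SinBounds

/-- `|sin θ|² = sin²(Re θ) + sinh²(Im θ)`. [folklore] -/
private theorem norm_sin_sq (θ : ℂ) : ‖Complex.sin θ‖ ^ 2 = Real.sin θ.re ^ 2 + Real.sinh θ.im ^ 2 := by
  have hθ : θ = (θ.re : ℂ) + (θ.im : ℂ) * Complex.I := (Complex.re_add_im θ).symm
  have hs : Complex.sin θ = ((Real.sin θ.re * Real.cosh θ.im : ℝ) : ℂ) +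
      ((Real.cos θ.re * Real.sinh θ.im : ℝ) : ℂ) * Complex.I := by
    conv_lhs => rw [hθ]
    rw [Complex.sin_add_mul_I]
    push_cast
    ring
  rw [hs, Complex.sq_norm, Complex.normSq_add_mul_I]
  have h1 := Real.cosh_sq θ.im
  have h2 := Real.sin_sq_add_cos_sq θ.re
  linear_combination (Real.sin θ.re ^ 2) * h1 + (Real.sinh θ.im ^ 2) * h2

/-- `|sin(Re θ)| ≤ |sin θ|`. [folklore] -/
private theorem abs_sin_re_le_norm_sin (θ : ℂ) : |Real.sin θ.re| ≤ ‖Complex.sin θ‖ := by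
  have h := norm_sin_sq θ
  have h0 : 0 ≤ ‖Complex.sin θ‖ := norm_nonneg _
  nlinarith [sq_nonneg (Real.sinh θ.im), sq_abs (Real.sin θ.re), abs_nonneg (Real.sin θ.re)]

/-- `|Im θ| ≤ |sin θ|` (`|sinh y| ≥ |y|`). [folklore] -/
private theorem abs_im_le_norm_sin (θ : ℂ) : |θ.im| ≤ ‖Complex.sin θ‖ := by
  have h := norm_sin_sq θ
  have h0 : 0 ≤ ‖Complex.sin θ‖ := norm_nonneg _
  have hy : |θ.im| ≤ |Real.sinh θ.im| := by
    rw [Real.abs_sinh]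
    exact Real.self_le_sinh_iff.mpr (abs_nonneg _)
  have hy2 : θ.im ^ 2 ≤ Real.sinh θ.im ^ 2 := by
    rw [← sq_abs θ.im, ← sq_abs (Real.sinh θ.im)]
    exact pow_le_pow_left₀ (abs_nonneg _) hy 2
  nlinarith [sq_nonneg (Real.sin θ.re), sq_abs θ.im, abs_nonneg θ.im]

/-- Jordan's inequality in `ℂ`: `|sin θ| ≥ (2/π)|θ|` for `|Re θ| ≤ π/2`. [folklore] -/
private theorem norm_sin_ge_of_abs_re_le (θ : ℂ) (hre : |θ.re| ≤ π / 2) :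
    2 / π * ‖θ‖ ≤ ‖Complex.sin θ‖ := by
  have hπ : 0 < π := Real.pi_pos
  have h := norm_sin_sq θ
  -- (2/π)|x| ≤ |sin x|
  have hx : 2 / π * |θ.re| ≤ |Real.sin θ.re| := by
    have hj := Real.mul_le_sin (abs_nonneg θ.re) hre
    rw [Real.abs_sin_eq_sin_abs_of_abs_le_pi (by linarith)]
    exact hj
  have hy : |θ.im| ≤ |Real.sinh θ.im| := by
    rw [Real.abs_sinh]
    exact Real.self_le_sinh_iff.mpr (abs_nonneg _)
  have h2π : 2 / π ≤ 1 := by rw [div_le_one hπ]; linarith [Real.pi_gt_three]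
  have hy' : 2 / π * |θ.im| ≤ |Real.sinh θ.im| := by
    calc 2 / π * |θ.im| ≤ 1 * |θ.im| := by gcongr
      _ = |θ.im| := one_mul _
      _ ≤ _ := hy
  -- square and add
  have hsq : (2 / π * ‖θ‖) ^ 2 ≤ ‖Complex.sin θ‖ ^ 2 := by
    rw [h, mul_pow, Complex.sq_norm, Complex.normSq_apply]
    have ha := pow_le_pow_left₀ (by positivity) hx 2
    have hb := pow_le_pow_left₀ (by positivity) hy' 2
    rw [mul_pow, sq_abs] at ha hb
    rw [sq_abs] at ha hb
    nlinarith [ha, hb]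
  exact (pow_le_pow_iff_left₀ (by positivity) (norm_nonneg _) two_ne_zero).mp hsq

end SinBounds

section NearPi

variable {γ : ℝ}

/-- **Near `θ = π`** (maximum principle): for `γ ≥ 1` and `‖θ − π‖ ≤ 1`, `‖h(θ)‖ ≤ πK e^{−γπ(π−2)}` — on the circle
`|w − π| = 1` one has `|sin w| ≥ 2/π` and the product bound (after the shift `w ↦ w − 2π` when `Re w > π`) gives
`‖h(w) sin w‖ ≤ 2K e^{γ − γ(π−1)²}`. [cite: MullerSchiemann1987, Appendix (A.8), (A.11) p.285] -/
theorem norm_hC_le_near_pi (hγ : 1 ≤ γ) {θ : ℂ} (hθ : ‖θ - π‖ ≤ 1) :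
    ‖hC γ θ‖ ≤ π * KP * Real.exp (-(γ * (π * (π - 2)))) := by
  have hγ0 : 0 < γ := by linarith
  have hπ : 0 < π := Real.pi_pos
  have hπ3 : (3 : ℝ) < π := Real.pi_gt_three
  have hcl : θ ∈ closure (Metric.ball (π : ℂ) 1) := by
    rw [closure_ball _ one_ne_zero, Metric.mem_closedBall, dist_eq_norm]
    exact hθ
  refine Complex.norm_le_of_forall_mem_frontier_norm_le (U := Metric.ball (π : ℂ) 1) Metric.isBounded_ball
    ((differentiable_hC hγ0).diffContOnCl) (fun w hw => ?_) hcl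
  rw [frontier_ball _ one_ne_zero, Metric.mem_sphere, dist_eq_norm] at hw
  -- u = w - π, ‖u‖ = 1
  have hure : |(w - π).re| ≤ 1 := (Complex.abs_re_le_norm _).trans hw.le
  have huim : |(w - π).im| ≤ 1 := (Complex.abs_im_le_norm _).trans hw.le
  have hwre : w.re = π + (w - π).re := by simp
  have hwim : w.im = (w - π).im := by simp
  -- |sin w| ≥ 2/π
  have hsin : 2 / π ≤ ‖Complex.sin w‖ := by
    have hw' : w = (w - π) + π := by ring
    have hs : Complex.sin w = -Complex.sin (w - π) := by
      conv_lhs => rw [hw']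
      rw [Complex.sin_add_pi]
    rw [hs, norm_neg]
    have := norm_sin_ge_of_abs_re_le (w - π) (hure.trans (by linarith))
    rwa [hw, mul_one] at this
  -- the product bound at w or at w − 2π
  have hprod : ‖hC γ w * Complex.sin w‖ ≤ 2 * KP * Real.exp (γ * 1 - γ * (π - 1) ^ 2) := by
    have hK : 0 ≤ 2 * KP := by linarith [KP_pos]
    rcases le_or_gt (w - π).re 0 with hneg | hpos
    · have hre : |w.re| ≤ π := by
        rw [hwre, abs_le]; constructor <;> linarith [abs_le.mp hure]
      have him : |w.im| ≤ 1 := by rwa [hwim]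
      refine (norm_hC_mul_sin_le hγ hre him).trans ?_
      refine mul_le_mul_of_nonneg_left (Real.exp_le_exp.mpr ?_) hK
      have h1 : w.im ^ 2 ≤ 1 := by
        have := abs_le.mp him
        nlinarith
      have h2 : (π - 1) ^ 2 ≤ w.re ^ 2 := by
        have hlo : π - 1 ≤ w.re := by rw [hwre]; linarith [abs_le.mp hure]
        have hlo' : 0 ≤ π - 1 := by linarith
        exact pow_le_pow_left₀ hlo' hlo 2
      nlinarith
    · -- shift by 2π
      have hshift : hC γ w * Complex.sin w = hC γ (w - 2 * π) * Complex.sin (w - 2 * π) := by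
        rw [hC_sub_two_pi, Complex.sin_sub_two_pi]
      rw [hshift]
      have hre : |(w - 2 * π).re| ≤ π := by
        have : (w - 2 * π).re = (w - π).re - π := by simp; ring
        rw [this, abs_le]; constructor <;> linarith [abs_le.mp hure]
      have him : |(w - 2 * π).im| ≤ 1 := by
        have : (w - 2 * π).im = (w - π).im := by simp
        rwa [this]
      refine (norm_hC_mul_sin_le hγ hre him).trans ?_
      refine mul_le_mul_of_nonneg_left (Real.exp_le_exp.mpr ?_) hK
      have h1 : (w - 2 * π).im ^ 2 ≤ 1 := by
        have := abs_le.mp him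
        nlinarith
      have h2 : (π - 1) ^ 2 ≤ (w - 2 * π).re ^ 2 := by
        have hval : (w - 2 * π).re = (w - π).re - π := by simp; ring
        have hhi : (w - 2 * π).re ≤ -(π - 1) := by rw [hval]; linarith [abs_le.mp hure]
        have hlo' : 0 ≤ π - 1 := by linarith
        have : (π - 1) ^ 2 ≤ (-(w - 2 * π).re) ^ 2 := pow_le_pow_left₀ hlo' (by linarith) 2
        rwa [neg_sq] at this
      nlinarith
  -- divide by |sin w|
  have hexp : Real.exp (γ * 1 - γ * (π - 1) ^ 2) = Real.exp (-(γ * (π * (π - 2)))) := by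
    congr 1; ring
  rw [hexp] at hprod
  have hs0 : 0 < ‖Complex.sin w‖ := lt_of_lt_of_le (by positivity) hsin
  have key : ‖hC γ w‖ * (2 / π) ≤ 2 * KP * Real.exp (-(γ * (π * (π - 2)))) := by
    calc ‖hC γ w‖ * (2 / π) ≤ ‖hC γ w‖ * ‖Complex.sin w‖ :=
          mul_le_mul_of_nonneg_left hsin (norm_nonneg _)
      _ = ‖hC γ w * Complex.sin w‖ := (norm_mul _ _).symm
      _ ≤ _ := hprod
  have : ‖hC γ w‖ ≤ 2 * KP * Real.exp (-(γ * (π * (π - 2)))) / (2 / π) := by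
    rw [le_div_iff₀ (by positivity)]; exact key
  calc ‖hC γ w‖ ≤ 2 * KP * Real.exp (-(γ * (π * (π - 2)))) / (2 / π) := this
    _ = π * KP * Real.exp (-(γ * (π * (π - 2)))) := by field_simp

/-- Near `θ = −π`, by evenness. [cite: MullerSchiemann1987, Appendix (A.8), (A.11) p.285] -/
theorem norm_hC_le_near_neg_pi (hγ : 1 ≤ γ) {θ : ℂ} (hθ : ‖θ + π‖ ≤ 1) :
    ‖hC γ θ‖ ≤ π * KP * Real.exp (-(γ * (π * (π - 2)))) := by
  rw [← hC_neg]
  refine norm_hC_le_near_pi hγ ?_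
  rwa [← norm_neg, neg_sub, sub_neg_eq_add, add_comm]

end NearPi

/-! ## §6 APPENDIX LEMMA (iv) for complex `θ` -/

section LemmaIV

variable {γ : ℝ}

/-- `β(γ) = γ − 1/6 + ρ₁(γ) → ∞`. [cite: MullerSchiemann1987, Appendix Lemma (iv) p.284] -/
theorem tendsto_betaIV_atTop : Tendsto betaIV atTop atTop := by
  have h1 : Tendsto (fun γ : ℝ => γ - 1 / 3) atTop atTop := tendsto_atTop_add_const_right _ _ tendsto_id
  refine tendsto_atTop_mono' atTop ?_ h1
  have hev : ∀ᶠ γ : ℝ in atTop, |rho1 γ| ≤ 1 / 6 := by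
    have h := (tendsto_rho1_zero.abs).eventually (gt_mem_nhds (show |(0:ℝ)| < 1 / 6 by norm_num))
    exact h.mono fun γ hγ => hγ.le
  filter_upwards [hev] with γ hγ
  unfold betaIV
  linarith [(abs_le.mp hγ).1]

set_option maxHeartbeats 400000 in -- v1.3 headroom: one long two-case estimate (≥ 90 % of the default budget)
/-- **APPENDIX LEMMA (iv), complex angles.** Let `0 < α < 1/2` and `κ² < 3/2`, i.e. `p = 5/8 < 1 − κ²/4`
(the print: «observing that p < 1 − κ²/4 + 𝒪(β^{−1+2α})», p.285 L.21–22; `α`, `κ` are the fixed parameters of Sect. 3).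
Then there is `γ₀` such that for all `γ ≥ γ₀`, with **`β = γ − 1/6 + ρ₁(γ)`** (`betaIV`): **in
`{|θ| > β^{−α}, |Re θ| ≤ π, |Im θ| < (κ/2)β^{−α}}`, `|h(θ)| < exp{β(Im θ)² − pβ^{1−2α}}`, `p = 5/8`** — as printed
(p.284: «(iv) In {|θ| > β^{−α}, |Re θ| ≤ π, |Im θ| < (κ/2)β^{−α}}, |h(θ)| < exp{β(Im θ)² − pβ^{1−2α}} with a constant
p = 5/8 and β := γ − 1/6 + ρ₁ large enough»), for the entire function `hC` of (A.1).  Proof («From these bounds follows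
(iv)», p.285): `ρ₁ → 0`, so eventually `β ≤ γ ≤ β + 1/3`; for `|Re θ| ≤ π − ½` the product bound of §4 and
`|sin θ| ≥ β^{−α}/π` give `|h| ≤ 2πKβ^{α}e^{γ(Im θ)² − γ(Re θ)²}` and `γ((Im θ)² − (Re θ)²) < 2γ(Im θ)² − γβ^{−2α}`,
`(2γ − β)(Im θ)² ≤ (β + 2/3)(κ²/4)β^{−2α}`, `γβ^{−2α} ≥ β^{1−2α}`, whence the claim once
`log(2πK) + κ²/6 + α log β ≤ (3/8 − κ²/4)β^{1−2α}`; for `π − ½ < |Re θ| ≤ π` the maximum principle of §5 gives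
`|h| ≤ πKe^{−γπ(π−2)} < e^{−(5/8)γ} ≤ e^{β(Im θ)² − (5/8)β^{1−2α}}` for `γ` large.
[cite: MullerSchiemann1987, Appendix Lemma (iv) p.284, proof p.285 L.18–22] -/
theorem lemma_iv {α κ : ℝ} (hα0 : 0 < α) (hα : α < 1 / 2) (hκ : κ ^ 2 < 3 / 2) :
    ∃ γ₀ : ℝ, ∀ γ : ℝ, γ₀ ≤ γ → ∀ θ : ℂ,
      (betaIV γ) ^ (-α) < ‖θ‖ → |θ.re| ≤ π → |θ.im| < κ / 2 * (betaIV γ) ^ (-α) →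
        ‖hC γ θ‖ < Real.exp (betaIV γ * θ.im ^ 2 - 5 / 8 * (betaIV γ) ^ (1 - 2 * α)) := by
  have hπ : 0 < π := Real.pi_pos
  have hπ3 : (3 : ℝ) < π := Real.pi_gt_three
  have hK : 0 < KP := KP_pos
  have he : 0 < 1 - 2 * α := by linarith
  set cκ : ℝ := 3 / 8 - κ ^ 2 / 4 with hcκ
  have hcκ0 : 0 < cκ := by rw [hcκ]; linarith
  -- eventual conditions in b = β, then transported to γ
  have evb1 : ∀ᶠ b : ℝ in atTop, (1 : ℝ) ≤ b := eventually_ge_atTop _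
  have evb2 : ∀ᶠ b : ℝ in atTop, κ / 2 * b ^ (-α) ≤ 1 / 2 := by
    have ht : Tendsto (fun b : ℝ => κ / 2 * b ^ (-α)) atTop (𝓝 (κ / 2 * 0)) :=
      (tendsto_rpow_neg_atTop hα0).const_mul _
    rw [mul_zero] at ht
    exact (ht.eventually (gt_mem_nhds (by norm_num : (0:ℝ) < 1 / 2))).mono fun b hb => hb.le
  have evb3 : ∀ᶠ b : ℝ in atTop, α * Real.log b ≤ cκ / 2 * b ^ (1 - 2 * α) := by
    have hlo := (isLittleO_log_rpow_atTop he).bound (show 0 < cκ / 2 / α by positivity)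
    filter_upwards [hlo, evb1] with b hb hb1
    rw [Real.norm_of_nonneg (Real.log_nonneg hb1), Real.norm_of_nonneg (Real.rpow_nonneg (by linarith) _)] at hb
    have := mul_le_mul_of_nonneg_left hb hα0.le
    calc α * Real.log b ≤ α * (cκ / 2 / α * b ^ (1 - 2 * α)) := this
      _ = cκ / 2 * b ^ (1 - 2 * α) := by field_simp
  have evb4 : ∀ᶠ b : ℝ in atTop, Real.log (2 * π * KP) + κ ^ 2 / 6 ≤ cκ / 2 * b ^ (1 - 2 * α) :=
    ((tendsto_rpow_atTop he).const_mul_atTop (by positivity : 0 < cκ / 2)).eventually_ge_atTop _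
  have evβ := tendsto_betaIV_atTop.eventually (((evb1.and evb2).and evb3).and evb4)
  have ev1 : ∀ᶠ γ : ℝ in atTop, (2 : ℝ) ≤ γ := eventually_ge_atTop _
  have ev2 : ∀ᶠ γ : ℝ in atTop, |rho1 γ| ≤ 1 / 6 := by
    have h := (tendsto_rho1_zero.abs).eventually (gt_mem_nhds (show |(0:ℝ)| < 1 / 6 by norm_num))
    exact h.mono fun γ hγ => hγ.le
  have ev3 : ∀ᶠ γ : ℝ in atTop, Real.log (π * KP) + 1 ≤ 19 / 8 * γ := by
    have ht : Tendsto (fun γ : ℝ => 19 / 8 * γ) atTop atTop := tendsto_id.const_mul_atTop (by norm_num)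
    exact ht.eventually_ge_atTop _
  obtain ⟨γ₀, hγ₀⟩ := (((evβ.and ev1).and ev2).and ev3).exists_forall_of_atTop
  refine ⟨γ₀, fun γ hγ θ hθlow hre him => ?_⟩
  obtain ⟨⟨⟨⟨⟨⟨hb1, hb2⟩, hb3⟩, hb4⟩, h1⟩, h2⟩, h3⟩ := hγ₀ γ hγ
  have hγ1 : (1 : ℝ) ≤ γ := by linarith
  have hγ0 : 0 < γ := by linarith
  -- β versus γ
  set β : ℝ := betaIV γ with hβdef
  have hρ := abs_le.mp h2
  have hβγ : β ≤ γ := by rw [hβdef, betaIV]; linarith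
  have hγβ : γ ≤ β + 1 / 3 := by rw [hβdef, betaIV]; linarith
  have hβ0 : 0 < β := by linarith
  -- x, y
  set x : ℝ := θ.re with hx
  set y : ℝ := θ.im with hy
  have hy0 : 0 < κ / 2 * β ^ (-α) := lt_of_le_of_lt (abs_nonneg _) him
  have hyhalf : |y| ≤ 1 / 2 := le_of_lt (lt_of_lt_of_le him hb2)
  have hy1 : |y| ≤ 1 := by linarith
  have hβα0 : 0 < β ^ (-α) := Real.rpow_pos_of_pos hβ0 _
  have hβα1 : β ^ (-α) ≤ 1 := Real.rpow_le_one_of_one_le_of_nonpos hb1 (by linarith)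
  -- powers of β
  have hpow1 : β ^ (1 - 2 * α) ≤ β := by
    have := Real.rpow_le_rpow_of_exponent_le hb1 (show 1 - 2 * α ≤ 1 by linarith)
    rwa [Real.rpow_one] at this
  have hpow3 : β * β ^ (-(2 * α)) = β ^ (1 - 2 * α) := by
    rw [show (1 - 2 * α) = 1 + -(2 * α) by ring, Real.rpow_add hβ0, Real.rpow_one]
  have hpow4 : (β ^ (-α)) ^ 2 = β ^ (-(2 * α)) := by
    rw [← Real.rpow_natCast, ← Real.rpow_mul hβ0.le]; congr 1; push_cast; ring
  have hβ2α1 : β ^ (-(2 * α)) ≤ 1 := Real.rpow_le_one_of_one_le_of_nonpos hb1 (by linarith)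
  have hβ12α0 : 0 < β ^ (1 - 2 * α) := Real.rpow_pos_of_pos hβ0 _
  -- y² < (κ²/4) β^{-2α}, |θ|² > β^{-2α}
  have hysq : y ^ 2 ≤ κ ^ 2 / 4 * β ^ (-(2 * α)) := by
    have h0 : 0 ≤ κ / 2 * β ^ (-α) := hy0.le
    have := mul_le_mul (le_of_lt him) (le_of_lt him) (abs_nonneg _) h0
    rw [← sq, sq_abs, ← sq, mul_pow, hpow4] at this
    calc y ^ 2 ≤ (κ / 2) ^ 2 * β ^ (-(2 * α)) := this
      _ = κ ^ 2 / 4 * β ^ (-(2 * α)) := by ring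
  have hθsq : β ^ (-(2 * α)) < x ^ 2 + y ^ 2 := by
    have h0 : 0 ≤ β ^ (-α) := hβα0.le
    have := mul_lt_mul'' hθlow hθlow h0 h0
    rw [← sq, hpow4, ← sq, Complex.sq_norm, Complex.normSq_apply] at this
    rw [hx, hy]; nlinarith [this]
  by_cases hcase : |x| ≤ π - 1 / 2
  · ---------------------------------------------------------------- Case A
    -- |sin θ| ≥ β^{-α}/π
    have hsin : 1 / π * β ^ (-α) ≤ ‖Complex.sin θ‖ := by
      by_cases hx2 : |x| ≤ π / 2
      · have hj := norm_sin_ge_of_abs_re_le θ hx2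
        have : 1 / π * β ^ (-α) ≤ 2 / π * ‖θ‖ := by
          rw [div_mul_eq_mul_div, div_mul_eq_mul_div]
          gcongr
          linarith [hθlow, hβα0]
        exact this.trans hj
      · have hx2' : π / 2 < |x| := lt_of_not_ge hx2
        -- |sin x| = sin(π - |x|) ≥ (2/π)(π - |x|) ≥ 1/π
        have hs1 : |Real.sin x| = Real.sin (π - |x|) := by
          rw [Real.sin_pi_sub, Real.abs_sin_eq_sin_abs_of_abs_le_pi hre]
        have hs2 : 2 / π * (π - |x|) ≤ Real.sin (π - |x|) :=
          Real.mul_le_sin (by linarith) (by linarith)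
        have hs3 : 1 / π ≤ |Real.sin x| := by
          rw [hs1]
          refine le_trans ?_ hs2
          rw [div_mul_eq_mul_div, div_le_div_iff_of_pos_right hπ]
          linarith
        calc 1 / π * β ^ (-α) ≤ 1 / π * 1 := by gcongr
          _ = 1 / π := mul_one _
          _ ≤ |Real.sin x| := hs3
          _ ≤ ‖Complex.sin θ‖ := abs_sin_re_le_norm_sin θ
    have hprod := norm_hC_mul_sin_le hγ1 hre hy1
    -- ‖hC θ‖ ≤ 2πK β^α e^{γ y² - γ x²}
    have hs0 : 0 < 1 / π * β ^ (-α) := by positivity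
    have hkey : ‖hC γ θ‖ * (1 / π * β ^ (-α)) ≤ 2 * KP * Real.exp (γ * y ^ 2 - γ * x ^ 2) := by
      calc ‖hC γ θ‖ * (1 / π * β ^ (-α)) ≤ ‖hC γ θ‖ * ‖Complex.sin θ‖ :=
            mul_le_mul_of_nonneg_left hsin (norm_nonneg _)
        _ = ‖hC γ θ * Complex.sin θ‖ := (norm_mul _ _).symm
        _ ≤ _ := hprod
    have hbound : ‖hC γ θ‖ ≤ 2 * KP * Real.exp (γ * y ^ 2 - γ * x ^ 2) * (π * β ^ α) := by
      have hinv : (1 / π * β ^ (-α)) * (π * β ^ α) = 1 := by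
        rw [Real.rpow_neg hβ0.le]
        field_simp
      have := mul_le_mul_of_nonneg_right hkey (by positivity : 0 ≤ π * β ^ α)
      rwa [mul_assoc, hinv, mul_one] at this
    refine lt_of_le_of_lt hbound ?_
    -- write everything as one exponential
    have hβα : β ^ α = Real.exp (α * Real.log β) := by
      rw [Real.rpow_def_of_pos hβ0]; ring_nf
    have hlhs : 2 * KP * Real.exp (γ * y ^ 2 - γ * x ^ 2) * (π * β ^ α) =
        Real.exp (Real.log (2 * π * KP) + α * Real.log β + (γ * y ^ 2 - γ * x ^ 2)) := by
      rw [Real.exp_add, Real.exp_add, Real.exp_log (by positivity), hβα]; ring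
    rw [hlhs]
    refine Real.exp_lt_exp.mpr ?_
    -- the exponent inequality, with the atoms P = β^{-2α}, Q = β^{1-2α}
    obtain ⟨P, hP⟩ : ∃ P : ℝ, β ^ (-(2 * α)) = P := ⟨_, rfl⟩
    obtain ⟨Q, hQ⟩ : ∃ Q : ℝ, β ^ (1 - 2 * α) = Q := ⟨_, rfl⟩
    rw [hP] at hθsq hysq hβ2α1 hpow3
    rw [hQ] at hpow3 hb3 hb4
    rw [hQ]
    have hA : γ * y ^ 2 - γ * x ^ 2 < 2 * (γ * y ^ 2) - γ * P := by
      have := mul_lt_mul_of_pos_left hθsq hγ0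
      linarith
    have h2γβ : 0 ≤ 2 * γ - β := by linarith
    have hB : (2 * γ - β) * y ^ 2 ≤ (2 * γ - β) * (κ ^ 2 / 4 * P) :=
      mul_le_mul_of_nonneg_left hysq h2γβ
    have hB2 : (2 * γ - β) * (κ ^ 2 / 4 * P) ≤ (β + 2 / 3) * (κ ^ 2 / 4 * P) :=
      mul_le_mul_of_nonneg_right (by linarith) (by rw [← hP]; positivity)
    have hC : Q ≤ γ * P := by
      rw [← hpow3]; exact mul_le_mul_of_nonneg_right hβγ (by rw [← hP]; positivity)
    have hκP : κ ^ 2 / 4 * P ≤ κ ^ 2 / 4 := by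
      have := mul_le_mul_of_nonneg_left hβ2α1 (by positivity : 0 ≤ κ ^ 2 / 4)
      linarith
    -- (2γ − β) y² ≤ (κ²/4) Q + κ²/6
    have hB' : 2 * (γ * y ^ 2) - β * y ^ 2 ≤ κ ^ 2 / 4 * Q + κ ^ 2 / 6 := by
      have e1 : (2 * γ - β) * y ^ 2 = 2 * (γ * y ^ 2) - β * y ^ 2 := by ring
      have e2 : (β + 2 / 3) * (κ ^ 2 / 4 * P) = κ ^ 2 / 4 * (β * P) + 2 / 3 * (κ ^ 2 / 4 * P) := by ring
      have h := hB.trans hB2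
      rw [e1, e2, hpow3] at h
      linarith
    have hF : cκ * Q = 3 / 8 * Q - κ ^ 2 / 4 * Q := by rw [hcκ]; ring
    linarith [hA, hB', hC, hb3, hb4, hF]
  · ---------------------------------------------------------------- Case B
    have hcase' : π - 1 / 2 < |x| := lt_of_not_ge hcase
    have hnear : ‖hC γ θ‖ ≤ π * KP * Real.exp (-(γ * (π * (π - 2)))) := by
      rcases le_or_gt 0 x with hxpos | hxneg
      · refine norm_hC_le_near_pi hγ1 ?_
        calc ‖θ - π‖ ≤ |(θ - π).re| + |(θ - π).im| := Complex.norm_le_abs_re_add_abs_im _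
          _ ≤ 1 / 2 + 1 / 2 := by
              gcongr
              · have : (θ - (π : ℂ)).re = x - π := by simp [hx]
                have hxle : x ≤ π := (abs_le.mp hre).2
                have hxge : π - 1 / 2 < x := by rwa [abs_of_nonneg hxpos] at hcase'
                rw [this, abs_le]; constructor <;> linarith
              · have : (θ - (π : ℂ)).im = y := by simp [hy]
                rw [this]; exact hyhalf
          _ = 1 := by norm_num
      · refine norm_hC_le_near_neg_pi hγ1 ?_
        calc ‖θ + π‖ ≤ |(θ + π).re| + |(θ + π).im| := Complex.norm_le_abs_re_add_abs_im _
          _ ≤ 1 / 2 + 1 / 2 := by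
              gcongr
              · have : (θ + (π : ℂ)).re = x + π := by simp [hx]
                rw [this]
                rw [abs_of_neg hxneg] at hcase' hre
                rw [abs_le]; constructor <;> linarith
              · have : (θ + (π : ℂ)).im = y := by simp [hy]
                rw [this]; exact hyhalf
          _ = 1 := by norm_num
    refine lt_of_le_of_lt hnear ?_
    have hlhs : π * KP * Real.exp (-(γ * (π * (π - 2)))) =
        Real.exp (Real.log (π * KP) + -(γ * (π * (π - 2)))) := by
      rw [Real.exp_add, Real.exp_log (by positivity)]
    rw [hlhs]
    refine Real.exp_lt_exp.mpr ?_
    have hππ : 3 ≤ π * (π - 2) := by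
      have h1' : (1 : ℝ) ≤ π - 2 := by linarith
      calc (3 : ℝ) = 3 * 1 := by norm_num
        _ ≤ π * (π - 2) := mul_le_mul hπ3.le h1' zero_le_one hπ.le
    have hy2 : 0 ≤ β * y ^ 2 := mul_nonneg hβ0.le (sq_nonneg y)
    have h58 : 5 / 8 * β ^ (1 - 2 * α) ≤ 5 / 8 * γ := by linarith [hpow1, hβγ]
    have hγππ : γ * 3 ≤ γ * (π * (π - 2)) := mul_le_mul_of_nonneg_left hππ hγ0.le
    linarith [h3, hy2, h58, hγππ]

end LemmaIV






/-! ## §7 (A.10) on the strip `𝒟 = {|Re θ| ≤ π − δ}`: `|h(θ)| ≤ exp{−γ Re θ² + O(1)}` for `γ ≥ 1` -/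

section A10Strip

variable {γ : ℝ}

/-- `cosh x ≤ e^{|x|}` (real). [folklore] -/
private theorem cosh_le_exp_abs'' (x : ℝ) : Real.cosh x ≤ Real.exp |x| := by
  rw [Real.cosh_eq]
  have h1 : Real.exp x ≤ Real.exp |x| := Real.exp_le_exp.mpr (le_abs_self x)
  have h2 : Real.exp (-x) ≤ Real.exp |x| := Real.exp_le_exp.mpr (neg_le_abs x)
  linarith

/-- `‖cosh w‖ ≤ cosh(Re w) ≤ e^{|Re w|}`. [folklore] -/
private theorem norm_cosh_le_exp_abs_re (w : ℂ) : ‖Complex.cosh w‖ ≤ Real.exp |w.re| := by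
  have h1 : ‖Complex.exp w‖ ≤ Real.exp |w.re| := by
    rw [Complex.norm_exp]; exact Real.exp_le_exp.mpr (le_abs_self _)
  have h2 : ‖Complex.exp (-w)‖ ≤ Real.exp |w.re| := by
    rw [Complex.norm_exp, Complex.neg_re]; exact Real.exp_le_exp.mpr (neg_le_abs _)
  have hcosh : Complex.cosh w = (Complex.exp w + Complex.exp (-w)) / 2 := rfl
  rw [hcosh, norm_div, Complex.norm_two]
  have := norm_add_le (Complex.exp w) (Complex.exp (-w))
  linarith

/-- `sinh y ≤ y cosh y` for `y ≥ 0` (termwise from the power series). [folklore] -/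
private theorem sinh_le_mul_cosh' {y : ℝ} (hy : 0 ≤ y) : Real.sinh y ≤ y * Real.cosh y := by
  have hs := Real.hasSum_sinh y
  have hc := (Real.hasSum_cosh y).mul_left y
  refine hasSum_le (fun n => ?_) hs hc
  have hf2 : (0 : ℝ) < ((2 * n + 1).factorial : ℝ) := by exact_mod_cast Nat.factorial_pos _
  have hfle : (((2 * n).factorial : ℕ) : ℝ) ≤ ((2 * n + 1).factorial : ℕ) := by
    exact_mod_cast Nat.factorial_le (by omega)
  rw [pow_succ, div_le_iff₀ hf2]
  calc y ^ (2 * n) * y = y * (y ^ (2 * n) / ((2 * n).factorial : ℝ)) * ((2 * n).factorial : ℝ) := by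
        field_simp
    _ ≤ y * (y ^ (2 * n) / ((2 * n).factorial : ℝ)) * ((2 * n + 1).factorial : ℝ) :=
        mul_le_mul_of_nonneg_left hfle (by positivity)

/-- `|sinh y| ≤ |y| cosh y` for every real `y`. [folklore] -/
private theorem abs_sinh_le_abs_mul_cosh' (y : ℝ) : |Real.sinh y| ≤ |y| * Real.cosh y := by
  rcases le_or_gt 0 y with hy | hy
  · rw [abs_of_nonneg (Real.sinh_nonneg_iff.mpr hy), abs_of_nonneg hy]
    exact sinh_le_mul_cosh' hy
  · have h := sinh_le_mul_cosh' (neg_nonneg.mpr hy.le)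
    rw [Real.sinh_neg, Real.cosh_neg] at h
    rw [abs_of_neg (Real.sinh_neg_iff.mpr hy), abs_of_neg hy]
    linarith

/-- `‖sinh w‖² = sinh²(Re w) + sin²(Im w)`. [folklore] -/
private theorem norm_sinh_sq (w : ℂ) : ‖Complex.sinh w‖ ^ 2 = Real.sinh w.re ^ 2 + Real.sin w.im ^ 2 := by
  have hw : w = (w.re : ℂ) + (w.im : ℂ) * Complex.I := (Complex.re_add_im w).symm
  have hs : Complex.sinh w = ((Real.sinh w.re * Real.cos w.im : ℝ) : ℂ) +
      ((Real.cosh w.re * Real.sin w.im : ℝ) : ℂ) * Complex.I := by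
    conv_lhs => rw [hw]
    rw [Complex.sinh_add, Complex.sinh_mul_I, Complex.cosh_mul_I]
    push_cast
    ring
  rw [hs, Complex.sq_norm, Complex.normSq_add_mul_I]
  have h1 := Real.cosh_sq w.re
  have h2 := Real.sin_sq_add_cos_sq w.im
  linear_combination (Real.sin w.im ^ 2) * h1 + (Real.sinh w.re ^ 2) * h2

/-- `‖sinh w‖ ≤ ‖w‖ cosh(Re w)`. [folklore] -/
private theorem norm_sinh_le (w : ℂ) : ‖Complex.sinh w‖ ≤ ‖w‖ * Real.cosh w.re := by
  have hc : 1 ≤ Real.cosh w.re := Real.one_le_cosh _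
  have h := norm_sinh_sq w
  have ha : Real.sinh w.re ^ 2 ≤ w.re ^ 2 * Real.cosh w.re ^ 2 := by
    have := abs_sinh_le_abs_mul_cosh' w.re
    have h0 : 0 ≤ |w.re| * Real.cosh w.re := by positivity
    have := pow_le_pow_left₀ (abs_nonneg _) this 2
    rw [sq_abs, mul_pow, sq_abs] at this
    exact this
  have hb : Real.sin w.im ^ 2 ≤ w.im ^ 2 * Real.cosh w.re ^ 2 := by
    have h1 : Real.sin w.im ^ 2 ≤ w.im ^ 2 := by
      rw [← sq_abs (Real.sin w.im), ← sq_abs w.im]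
      exact pow_le_pow_left₀ (abs_nonneg _) (Real.abs_sin_le_abs) 2
    have h2 : w.im ^ 2 ≤ w.im ^ 2 * Real.cosh w.re ^ 2 := by
      have : 1 ≤ Real.cosh w.re ^ 2 := by nlinarith
      nlinarith [sq_nonneg w.im]
    exact h1.trans h2
  have hsq : ‖Complex.sinh w‖ ^ 2 ≤ (‖w‖ * Real.cosh w.re) ^ 2 := by
    rw [h, mul_pow, Complex.sq_norm, Complex.normSq_apply]
    nlinarith [ha, hb]
  exact (pow_le_pow_iff_left₀ (norm_nonneg _) (by positivity) two_ne_zero).mp hsq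

/-- The termwise estimate behind (A.10) on the strip: for `γ ≥ 1`, `|Re θ| ≤ π − δ`,
`‖[θ cosh(a_nθ) − 2π(n+1) sinh(a_nθ)] e^{−4π²γ(n+1)²}‖ ≤ ‖θ‖ (1 + 4π(n+1)²/δ) e^{−2πδ(n+1)}` — as on the real axis
(`MS87HeatKernelLargeGamma`), with `|cosh(a_nθ)| ≤ e^{a_n|Re θ|}` and `|sinh(a_nθ)| ≤ a_n|θ| e^{a_n|Re θ|}`.
[cite: MullerSchiemann1987, Appendix (A.10) p.285] -/
private theorem norm_brace_term_le_strip (hγ : 1 ≤ γ) {δ : ℝ} (hδ : 0 < δ) {θ : ℂ} (hre : |θ.re| ≤ π - δ)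
    (n : ℕ) :
    ‖(θ * Complex.cosh (4 * π * γ * ((n : ℂ) + 1) * θ)
        - 2 * π * ((n : ℂ) + 1) * Complex.sinh (4 * π * γ * ((n : ℂ) + 1) * θ))
        * Complex.exp (-(4 * π ^ 2 * γ * ((n : ℂ) + 1) ^ 2))‖
      ≤ ‖θ‖ * ((1 + 4 * π * ((n : ℝ) + 1) ^ 2 / δ) * Real.exp (-(2 * π * δ * ((n : ℝ) + 1)))) := by
  have hπ : 0 < π := Real.pi_pos
  have hγ0 : 0 < γ := by linarith
  have hn1 : (1 : ℝ) ≤ (n : ℝ) + 1 := by have : (0:ℝ) ≤ n := n.cast_nonneg; linarith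
  set a : ℝ := 4 * π * γ * ((n : ℝ) + 1) with ha
  have ha0 : 0 < a := by positivity
  set w : ℂ := 4 * π * γ * ((n : ℂ) + 1) * θ with hw
  have hw' : w = (a : ℂ) * θ := by rw [hw, ha]; push_cast; ring
  have hwre : w.re = a * θ.re := by rw [hw']; simp
  have hwnorm : ‖w‖ = a * ‖θ‖ := by rw [hw', norm_mul, Complex.norm_real, Real.norm_of_nonneg ha0.le]
  -- the Gaussian weight is real
  have hE : Complex.exp (-(4 * π ^ 2 * γ * ((n : ℂ) + 1) ^ 2)) =
      ((Real.exp (-(4 * π ^ 2 * γ * ((n : ℝ) + 1) ^ 2)) : ℝ) : ℂ) := by push_cast; ring_nf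
  rw [hE, norm_mul, Complex.norm_real, Real.norm_of_nonneg (Real.exp_pos _).le]
  -- |cosh w| ≤ e^{a|x|}, |sinh w| ≤ a|θ| e^{a|x|}
  have hcosh : ‖Complex.cosh w‖ ≤ Real.exp (a * |θ.re|) := by
    have := norm_cosh_le_exp_abs_re w
    rwa [hwre, abs_mul, abs_of_pos ha0] at this
  have hsinh : ‖Complex.sinh w‖ ≤ a * ‖θ‖ * Real.exp (a * |θ.re|) := by
    have h1 := norm_sinh_le w
    rw [hwnorm, hwre] at h1
    refine h1.trans (mul_le_mul_of_nonneg_left ?_ (by positivity))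
    have := cosh_le_exp_abs'' (a * θ.re)
    rwa [abs_mul, abs_of_pos ha0] at this
  -- Step 1: ‖θ cosh w − 2π(n+1) sinh w‖ ≤ ‖θ‖ (1 + 8π²γ(n+1)²) e^{a|x|}
  have hcoef : (2 * (π : ℂ) * ((n : ℂ) + 1)) = ((2 * π * ((n : ℝ) + 1) : ℝ) : ℂ) := by push_cast; ring
  have hnn : (0 : ℝ) ≤ 2 * π * ((n : ℝ) + 1) := by positivity
  have h1 : ‖θ * Complex.cosh w - 2 * π * ((n : ℂ) + 1) * Complex.sinh w‖
      ≤ ‖θ‖ * (1 + 8 * π ^ 2 * γ * ((n : ℝ) + 1) ^ 2) * Real.exp (a * |θ.re|) := by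
    calc ‖θ * Complex.cosh w - 2 * π * ((n : ℂ) + 1) * Complex.sinh w‖
        ≤ ‖θ * Complex.cosh w‖ + ‖2 * (π : ℂ) * ((n : ℂ) + 1) * Complex.sinh w‖ := norm_sub_le _ _
      _ = ‖θ‖ * ‖Complex.cosh w‖ + 2 * π * ((n : ℝ) + 1) * ‖Complex.sinh w‖ := by
          rw [norm_mul, hcoef, norm_mul, Complex.norm_real, Real.norm_of_nonneg hnn]
      _ ≤ ‖θ‖ * Real.exp (a * |θ.re|) + 2 * π * ((n : ℝ) + 1) * (a * ‖θ‖ * Real.exp (a * |θ.re|)) := by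
          gcongr
      _ = ‖θ‖ * (1 + 8 * π ^ 2 * γ * ((n : ℝ) + 1) ^ 2) * Real.exp (a * |θ.re|) := by rw [ha]; ring
  -- Step 2: e^{a|x|} e^{−4π²γ(n+1)²} ≤ e^{−4πγδ(n+1)}
  have h2 : Real.exp (a * |θ.re|) * Real.exp (-(4 * π ^ 2 * γ * ((n : ℝ) + 1) ^ 2))
      ≤ Real.exp (-(4 * π * γ * δ * ((n : ℝ) + 1))) := by
    rw [← Real.exp_add]
    apply Real.exp_le_exp.mpr
    have hk : a * |θ.re| ≤ a * (π - δ) := mul_le_mul_of_nonneg_left hre ha0.le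
    have hpos : 0 ≤ 4 * π * γ * ((n : ℝ) + 1) * (π * ((n : ℝ) + 1) - π) := by
      have : 0 ≤ π * ((n : ℝ) + 1) - π := by nlinarith
      positivity
    rw [ha] at hk ⊢
    nlinarith
  -- Step 3: (1 + s_n) e^{−4πγδ(n+1)} ≤ (1 + 4π(n+1)²/δ) e^{−2πδ(n+1)}
  have h3 : (1 + 8 * π ^ 2 * γ * ((n : ℝ) + 1) ^ 2) * Real.exp (-(4 * π * γ * δ * ((n : ℝ) + 1)))
      ≤ (1 + 4 * π * ((n : ℝ) + 1) ^ 2 / δ) * Real.exp (-(2 * π * δ * ((n : ℝ) + 1))) := by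
    have hsplit : Real.exp (-(4 * π * γ * δ * ((n : ℝ) + 1)))
        ≤ Real.exp (-(2 * π * δ * γ)) * Real.exp (-(2 * π * δ * ((n : ℝ) + 1))) := by
      rw [← Real.exp_add]
      apply Real.exp_le_exp.mpr
      have hprod : 2 * π * δ * γ + 2 * π * δ * ((n : ℝ) + 1) ≤ 4 * π * γ * δ * ((n : ℝ) + 1) := by
        nlinarith [mul_nonneg (mul_nonneg (by positivity : (0:ℝ) ≤ 2 * π * δ) (sub_nonneg.mpr hγ))
          (sub_nonneg.mpr hn1), mul_nonneg (by positivity : (0:ℝ) ≤ 2 * π * δ) (sub_nonneg.mpr hn1),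
          mul_nonneg (by positivity : (0:ℝ) ≤ 2 * π * δ) (sub_nonneg.mpr hγ)]
      linarith
    have hγexp : γ * Real.exp (-(2 * π * δ * γ)) ≤ 1 / (2 * π * δ) := by
      have hpos : 0 < 2 * π * δ := by positivity
      have h := Real.add_one_le_exp (2 * π * δ * γ)
      rw [Real.exp_neg, ← div_eq_mul_inv, div_le_div_iff₀ (Real.exp_pos _) hpos]
      nlinarith [Real.exp_pos (2 * π * δ * γ)]
    have he1 : Real.exp (-(2 * π * δ * γ)) ≤ 1 := by
      rw [Real.exp_le_one_iff]; have : 0 ≤ 2 * π * δ * γ := by positivity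
      linarith
    have hE0 : 0 ≤ Real.exp (-(2 * π * δ * ((n : ℝ) + 1))) := (Real.exp_pos _).le
    have hs0 : 0 ≤ 1 + 8 * π ^ 2 * γ * ((n : ℝ) + 1) ^ 2 := by positivity
    calc (1 + 8 * π ^ 2 * γ * ((n : ℝ) + 1) ^ 2) * Real.exp (-(4 * π * γ * δ * ((n : ℝ) + 1)))
        ≤ (1 + 8 * π ^ 2 * γ * ((n : ℝ) + 1) ^ 2) *
            (Real.exp (-(2 * π * δ * γ)) * Real.exp (-(2 * π * δ * ((n : ℝ) + 1)))) :=
          mul_le_mul_of_nonneg_left hsplit hs0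
      _ = (Real.exp (-(2 * π * δ * γ)) + 8 * π ^ 2 * ((n : ℝ) + 1) ^ 2 * (γ * Real.exp (-(2 * π * δ * γ))))
            * Real.exp (-(2 * π * δ * ((n : ℝ) + 1))) := by ring
      _ ≤ (1 + 8 * π ^ 2 * ((n : ℝ) + 1) ^ 2 * (1 / (2 * π * δ))) * Real.exp (-(2 * π * δ * ((n : ℝ) + 1))) := by
          gcongr
      _ = (1 + 4 * π * ((n : ℝ) + 1) ^ 2 / δ) * Real.exp (-(2 * π * δ * ((n : ℝ) + 1))) := by
          field_simp
          ring
  -- assemble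
  have hθ0 : 0 ≤ ‖θ‖ := norm_nonneg _
  have hs0 : 0 ≤ 1 + 8 * π ^ 2 * γ * ((n : ℝ) + 1) ^ 2 := by positivity
  calc ‖θ * Complex.cosh w - 2 * π * ((n : ℂ) + 1) * Complex.sinh w‖ *
        Real.exp (-(4 * π ^ 2 * γ * ((n : ℝ) + 1) ^ 2))
      ≤ ‖θ‖ * (1 + 8 * π ^ 2 * γ * ((n : ℝ) + 1) ^ 2) * Real.exp (a * |θ.re|) *
          Real.exp (-(4 * π ^ 2 * γ * ((n : ℝ) + 1) ^ 2)) :=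
        mul_le_mul_of_nonneg_right h1 (Real.exp_pos _).le
    _ = ‖θ‖ * ((1 + 8 * π ^ 2 * γ * ((n : ℝ) + 1) ^ 2) *
          (Real.exp (a * |θ.re|) * Real.exp (-(4 * π ^ 2 * γ * ((n : ℝ) + 1) ^ 2)))) := by ring
    _ ≤ ‖θ‖ * ((1 + 8 * π ^ 2 * γ * ((n : ℝ) + 1) ^ 2) * Real.exp (-(4 * π * γ * δ * ((n : ℝ) + 1)))) :=
        mul_le_mul_of_nonneg_left (mul_le_mul_of_nonneg_left h2 hs0) hθ0
    _ ≤ ‖θ‖ * ((1 + 4 * π * ((n : ℝ) + 1) ^ 2 / δ) * Real.exp (-(2 * π * δ * ((n : ℝ) + 1)))) :=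
        mul_le_mul_of_nonneg_left h3 hθ0


/-- The series `M(δ)` converges (`δ > 0`; as in `MS87HeatKernelLargeGamma`, private there). [folklore] -/
private theorem summable_MA10_term' {δ : ℝ} (hδ : 0 < δ) :
    Summable fun n : ℕ => (1 + 4 * π * ((n : ℝ) + 1) ^ 2 / δ) * Real.exp (-(2 * π * δ * ((n : ℝ) + 1))) := by
  have hr : 0 < 2 * π * δ := by positivity
  have h0 := (summable_nat_add_iff 1).mpr (Real.summable_pow_mul_exp_neg_nat_mul 0 hr)
  have h2 := (summable_nat_add_iff 1).mpr (Real.summable_pow_mul_exp_neg_nat_mul 2 hr)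
  refine ((h0).add (h2.mul_left (4 * π / δ))).congr fun n => ?_
  push_cast
  ring_nf

/-- `M(δ) ≥ 0`. [folklore] -/
private theorem MA10_nonneg' {δ : ℝ} (hδ : 0 < δ) : 0 ≤ MA10 δ := by
  unfold MA10
  exact tsum_nonneg fun n => by positivity

/-- `‖T(θ)‖ ≤ ‖θ‖·M(δ)` on the strip `|Re θ| ≤ π − δ`, `γ ≥ 1`. [cite: MullerSchiemann1987, Appendix (A.10) p.285] -/
private theorem norm_brace_tsum_le_strip (hγ : 1 ≤ γ) {δ : ℝ} (hδ : 0 < δ) {θ : ℂ} (hre : |θ.re| ≤ π - δ) :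
    ‖∑' n : ℕ, (θ * Complex.cosh (4 * π * γ * ((n : ℂ) + 1) * θ)
        - 2 * π * ((n : ℂ) + 1) * Complex.sinh (4 * π * γ * ((n : ℂ) + 1) * θ))
        * Complex.exp (-(4 * π ^ 2 * γ * ((n : ℂ) + 1) ^ 2))‖ ≤ ‖θ‖ * MA10 δ := by
  unfold MA10
  rw [← tsum_mul_left]
  exact tsum_of_norm_bounded ((summable_MA10_term' hδ).mul_left ‖θ‖).hasSum
    fun n => norm_brace_term_le_strip hγ hδ hre n

/-- On the strip `|Re θ| ≤ π − δ` (`0 < δ ≤ π/2`): `‖θ‖ ≤ (π/sin δ)‖sin θ‖`. [folklore] -/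
private theorem norm_le_div_sin_mul_norm_sin {δ : ℝ} (hδ : 0 < δ) (hδ2 : δ ≤ π / 2) {θ : ℂ}
    (hre : |θ.re| ≤ π - δ) : ‖θ‖ ≤ π / Real.sin δ * ‖Complex.sin θ‖ := by
  have hπ : 0 < π := Real.pi_pos
  have hπ3 : (3 : ℝ) < π := Real.pi_gt_three
  have hsδ : 0 < Real.sin δ := Real.sin_pos_of_pos_of_lt_pi hδ (by linarith)
  have hsδ1 : Real.sin δ ≤ 1 := Real.sin_le_one δ
  have hq : π ≤ π / Real.sin δ := by
    rw [le_div_iff₀ hsδ]; nlinarith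
  by_cases hx : |θ.re| ≤ π / 2
  · have hj := norm_sin_ge_of_abs_re_le θ hx
    have : ‖θ‖ ≤ π / 2 * ‖Complex.sin θ‖ := by
      have := mul_le_mul_of_nonneg_left hj (by positivity : (0:ℝ) ≤ π / 2)
      have e : π / 2 * (2 / π * ‖θ‖) = ‖θ‖ := by field_simp
      linarith [e]
    refine this.trans (mul_le_mul_of_nonneg_right ?_ (norm_nonneg _))
    linarith
  · have hx' : π / 2 < |θ.re| := lt_of_not_ge hx
    -- sin²(Re θ) ≥ sin² δ
    have hs1 : Real.sin δ ≤ |Real.sin θ.re| := by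
      rw [Real.abs_sin_eq_sin_abs_of_abs_le_pi (by linarith)]
      have hps : Real.sin (π - |θ.re|) = Real.sin |θ.re| := Real.sin_pi_sub _
      rw [← hps]
      exact Real.sin_le_sin_of_le_of_le_pi_div_two (by linarith) (by linarith) (by linarith)
    have h := norm_sin_sq θ
    have hy2 : θ.im ^ 2 ≤ Real.sinh θ.im ^ 2 := by
      have hy : |θ.im| ≤ |Real.sinh θ.im| := by
        rw [Real.abs_sinh]; exact Real.self_le_sinh_iff.mpr (abs_nonneg _)
      rw [← sq_abs θ.im, ← sq_abs (Real.sinh θ.im)]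
      exact pow_le_pow_left₀ (abs_nonneg _) hy 2
    have hsin2 : Real.sin δ ^ 2 ≤ Real.sin θ.re ^ 2 := by
      rw [← sq_abs (Real.sin θ.re)]; exact pow_le_pow_left₀ hsδ.le hs1 2
    have hx2 : θ.re ^ 2 ≤ π ^ 2 := by
      rw [← sq_abs θ.re]; exact pow_le_pow_left₀ (abs_nonneg _) (by linarith) 2
    have hq1 : 1 ≤ (π / Real.sin δ) ^ 2 := by
      have : 1 ≤ π / Real.sin δ := by linarith
      nlinarith
    have hsq : ‖θ‖ ^ 2 ≤ (π / Real.sin δ * ‖Complex.sin θ‖) ^ 2 := by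
      rw [mul_pow, h, Complex.sq_norm, Complex.normSq_apply]
      have e : (π / Real.sin δ) ^ 2 * Real.sin δ ^ 2 = π ^ 2 := by
        field_simp
      nlinarith [hsin2, hy2, hx2, hq1, e, sq_nonneg θ.im]
    exact (pow_le_pow_iff_left₀ (norm_nonneg _) (by positivity) two_ne_zero).mp hsq

/-- **(A.10) on the whole strip `𝒟 = {|Re θ| ≤ π − δ}`**, uniformly in `γ ≥ 1` and in `Im θ`, explicit constant: for
`0 < δ ≤ π/2`, `γ ≥ 1` and every complex `θ` with `|Re θ| ≤ π − δ`,
`‖h(θ)‖ ≤ 2(1 + 2M(δ))(π/sin δ) e^{γ(Im θ)² − γ(Re θ)²}` (`M = MA10`), i.e. the print's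
«|h(θ)| ≤ exp{−γ Re θ² + 𝒪(1)}, θ ∈ 𝒟» with `|e^{−γθ²}| = e^{−γ Re(θ²)}`, `Re(θ²) = (Re θ)² − (Im θ)²`: from (A.7) on `ℂ`
in the printed form, the termwise bound `norm_brace_term_le_strip`, (A.9) `𝒩′ ≤ 2` and `‖θ‖ ≤ (π/sin δ)‖sin θ‖` on the
strip. [cite: MullerSchiemann1987, Appendix (A.10) p.285] -/
theorem norm_hC_le_A10 (hγ : 1 ≤ γ) {δ : ℝ} (hδ : 0 < δ) (hδ2 : δ ≤ π / 2) {θ : ℂ} (hre : |θ.re| ≤ π - δ) :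
    ‖hC γ θ‖ ≤ 2 * (1 + 2 * MA10 δ) * (π / Real.sin δ) * Real.exp (γ * θ.im ^ 2 - γ * θ.re ^ 2) := by
  have hγ0 : 0 < γ := by linarith
  have hπ : 0 < π := Real.pi_pos
  have hπ3 : (3 : ℝ) < π := Real.pi_gt_three
  have hM := MA10_nonneg' hδ
  have hsδ : 0 < Real.sin δ := Real.sin_pos_of_pos_of_lt_pi hδ (by linarith)
  have hq : 1 ≤ π / Real.sin δ := by
    rw [le_div_iff₀ hsδ]; linarith [Real.sin_le_one δ]
  have hN1 : 1 ≤ normN' γ := one_le_normN' (by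
    have : 1 / (8 * π ^ 2) ≤ 1 := by rw [div_le_one (by positivity)]; nlinarith
    linarith)
  have hN2 := normN'_le_two hγ
  by_cases hθ : θ = 0
  · subst hθ
    rw [hC_zero hγ0, norm_one]
    simp only [Complex.zero_re, Complex.zero_im]
    have : Real.exp (γ * (0:ℝ) ^ 2 - γ * (0:ℝ) ^ 2) = 1 := by simp
    rw [this]
    nlinarith
  -- sin θ ≠ 0 on the strip
  have hsin : Complex.sin θ ≠ 0 := by
    intro h0
    obtain ⟨k, hk⟩ := Complex.sin_eq_zero_iff.mp h0
    have hkre : θ.re = k * π := by rw [hk]; simp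
    have hk0 : k ≠ 0 := by
      rintro rfl
      apply hθ
      rw [hk]; simp
    have hk1 : (1 : ℝ) ≤ |(k : ℝ)| := by
      rw [← Int.cast_abs]; exact_mod_cast Int.one_le_abs hk0
    have : π ≤ |θ.re| := by
      rw [hkre, abs_mul, abs_of_pos hπ]; nlinarith
    linarith
  have hs0 : 0 < ‖Complex.sin θ‖ := norm_pos_iff.mpr hsin
  -- the product
  have hprod : ‖hC γ θ * Complex.sin θ‖ ≤
      2 * Real.exp (γ * θ.im ^ 2 - γ * θ.re ^ 2) * (‖θ‖ * (1 + 2 * MA10 δ)) := by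
    rw [hC_mul_sin_eq_A7_brace hγ0, norm_mul, norm_mul, Complex.norm_real, Real.norm_of_nonneg (by linarith)]
    have hE : ‖Complex.exp (-(γ * θ ^ 2))‖ = Real.exp (γ * θ.im ^ 2 - γ * θ.re ^ 2) := by
      rw [Complex.norm_exp]; congr 1; simp [Complex.mul_re, pow_two]; ring
    rw [hE]
    have hB : ‖θ + 2 * ∑' n : ℕ, (θ * Complex.cosh (4 * π * γ * ((n : ℂ) + 1) * θ)
        - 2 * π * ((n : ℂ) + 1) * Complex.sinh (4 * π * γ * ((n : ℂ) + 1) * θ))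
        * Complex.exp (-(4 * π ^ 2 * γ * ((n : ℂ) + 1) ^ 2))‖ ≤ ‖θ‖ * (1 + 2 * MA10 δ) := by
      refine (norm_add_le _ _).trans ?_
      rw [norm_mul, Complex.norm_two]
      have := norm_brace_tsum_le_strip hγ hδ hre
      nlinarith [norm_nonneg θ]
    have h0 : 0 ≤ Real.exp (γ * θ.im ^ 2 - γ * θ.re ^ 2) := (Real.exp_pos _).le
    exact mul_le_mul (mul_le_mul_of_nonneg_right hN2 h0) hB (norm_nonneg _) (by positivity)
  -- divide by ‖sin θ‖ using ‖θ‖ ≤ (π / sin δ) ‖sin θ‖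
  have hθs := norm_le_div_sin_mul_norm_sin hδ hδ2 hre
  rw [norm_mul] at hprod
  have key : ‖hC γ θ‖ * ‖Complex.sin θ‖ ≤
      (2 * (1 + 2 * MA10 δ) * (π / Real.sin δ) * Real.exp (γ * θ.im ^ 2 - γ * θ.re ^ 2)) * ‖Complex.sin θ‖ := by
    calc ‖hC γ θ‖ * ‖Complex.sin θ‖ ≤ 2 * Real.exp (γ * θ.im ^ 2 - γ * θ.re ^ 2) * (‖θ‖ * (1 + 2 * MA10 δ)) := hprod
      _ ≤ 2 * Real.exp (γ * θ.im ^ 2 - γ * θ.re ^ 2) * ((π / Real.sin δ * ‖Complex.sin θ‖) * (1 + 2 * MA10 δ)) := by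
          gcongr
      _ = _ := by ring
  exact le_of_mul_le_mul_right key hs0

/-- **(A.10) as printed, on `𝒟`**: for `0 < δ ≤ π/2` there is `A` with `‖h(θ)‖ ≤ exp{−γ Re(θ²) + A}` for all `γ ≥ 1`
and all complex `θ` with `|Re θ| ≤ π − δ` — «|h(θ)| ≤ exp{−γ Re θ² + 𝒪(1)}, θ ∈ 𝒟 … valid for γ → ∞».
[cite: MullerSchiemann1987, Appendix (A.10) p.285] -/
theorem norm_hC_le_exp_A10 {δ : ℝ} (hδ : 0 < δ) (hδ2 : δ ≤ π / 2) :
    ∃ A : ℝ, ∀ γ : ℝ, 1 ≤ γ → ∀ θ : ℂ, |θ.re| ≤ π - δ →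
      ‖hC γ θ‖ ≤ Real.exp (-(γ * (θ ^ 2).re) + A) := by
  have hπ : 0 < π := Real.pi_pos
  have hsδ : 0 < Real.sin δ := Real.sin_pos_of_pos_of_lt_pi hδ (by linarith [Real.pi_gt_three])
  have hC0 : 0 < 2 * (1 + 2 * MA10 δ) * (π / Real.sin δ) := by
    have := MA10_nonneg' hδ; positivity
  refine ⟨Real.log (2 * (1 + 2 * MA10 δ) * (π / Real.sin δ)), fun γ hγ θ hre => ?_⟩
  refine (norm_hC_le_A10 hγ hδ hδ2 hre).trans (le_of_eq ?_)
  rw [Real.exp_add, Real.exp_log hC0, mul_comm]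
  congr 1
  congr 1
  simp [Complex.mul_re, pow_two]; ring

end A10Strip

/-! ## §8 (A.8) on `ℂ` and (A.11) on the strip `{|Re θ̌| ≤ δ}`: `|h(θ)| ≤ exp{−γπ(π−2δ) − γ Re θ̌² + O(ln γ)}` -/

section A11Strip

variable {γ : ℝ}

/-- The `n`-th term of (A.8) on `ℂ` (`m = n + ½`): `[2πm sinh(4πγmθ̌) − θ̌ cosh(4πγmθ̌)] e^{−4π²γm²}`.
[cite: MullerSchiemann1987, Appendix (A.8) p.285] -/
def termA8C (γ : ℝ) (n : ℕ) (θc : ℂ) : ℂ :=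
  (2 * π * ((n : ℂ) + 1 / 2) * Complex.sinh (4 * π * γ * ((n : ℂ) + 1 / 2) * θc)
    - θc * Complex.cosh (4 * π * γ * ((n : ℂ) + 1 / 2) * θc))
    * Complex.exp (-(4 * π ^ 2 * γ * ((n : ℂ) + 1 / 2) ^ 2))

/-- Each term of (A.8) is entire. [folklore] -/
private theorem differentiable_termA8C (γ : ℝ) (n : ℕ) : Differentiable ℂ (termA8C γ n) := by
  unfold termA8C
  fun_prop

/-- The Gaussian weights `e^{cn − 4π²γn²}` are summable over `ℕ` for every real `c`. [folklore] -/
private theorem summable_nat_exp_lin_sub_sq (hγ : 0 < γ) (c : ℝ) :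
    Summable fun n : ℕ => Real.exp (c * n - 4 * π ^ 2 * γ * (n : ℝ) ^ 2) := by
  -- via the Jacobi theta summability at imaginary argument (as in `MS87HeatKernelSU2` §10)
  have hT : 0 < (((4 * π * γ : ℝ)) * Complex.I : ℂ).im := by simp; positivity
  have h := (hasSum_jacobiTheta₂_term ((-(c / (2 * π)) : ℝ) * Complex.I) hT).summable
  have h' : Summable fun n : ℤ => ((Real.exp (c * n - 4 * π ^ 2 * γ * (n : ℝ) ^ 2) : ℝ) : ℂ) := by
    refine h.congr fun n => ?_
    rw [jacobiTheta₂_term, Complex.ofReal_exp]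
    congr 1
    have hπ : (π : ℂ) ≠ 0 := Complex.ofReal_ne_zero.mpr Real.pi_ne_zero
    push_cast
    field_simp
    linear_combination (-((n : ℂ) * (c : ℂ)) + (n : ℂ) ^ 2 * (π : ℂ) ^ 2 * (γ : ℂ) * 4) * Complex.I_sq
  have h'' := Complex.summable_ofReal.mp h'
  exact h''.comp_injective Nat.cast_injective

/-- Polynomial weights: `(n + ½)² e^{cm − 4π²γm²}`-type terms are summable — here in the form needed below:
`Σ_n (A + B(n+½)) e^{c(n+½) − 4π²γ(n+½)²} < ∞` and with `(n+½)²`. [folklore] -/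
private theorem summable_A8_majorant (hγ : 0 < γ) (A B c : ℝ) :
    Summable fun n : ℕ => (A + B * ((n : ℝ) + 1 / 2) ^ 2) *
      Real.exp (c * ((n : ℝ) + 1 / 2) - 4 * π ^ 2 * γ * ((n : ℝ) + 1 / 2) ^ 2) := by
  -- (n+½)² ≤ 2 e^{n+½}; reduce to Σ e^{c'n − 4π²γn²}
  have key : ∀ c' : ℝ, Summable fun n : ℕ =>
      Real.exp (c' * ((n : ℝ) + 1 / 2) - 4 * π ^ 2 * γ * ((n : ℝ) + 1 / 2) ^ 2) := by
    intro c'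
    have h := (summable_nat_exp_lin_sub_sq hγ (c' - 4 * π ^ 2 * γ)).mul_left (Real.exp (c' / 2 - π ^ 2 * γ))
    refine h.congr fun n => ?_
    rw [← Real.exp_add]; congr 1; ring
  have h1 := (key c).mul_left A
  have h2 := (key (c + 1)).mul_left (2 * |B|)
  refine Summable.of_norm_bounded (h1.norm.add h2) fun n => ?_
  rw [Real.norm_eq_abs]
  have hm0 : (0 : ℝ) ≤ (n : ℝ) + 1 / 2 := by positivity
  have hsq : ((n : ℝ) + 1 / 2) ^ 2 ≤ 2 * Real.exp ((n : ℝ) + 1 / 2) := by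
    have := Real.add_one_le_exp ((n : ℝ) + 1 / 2)
    have h3 : ((n : ℝ) + 1 / 2) ^ 2 / 2 ≤ Real.exp ((n : ℝ) + 1 / 2) := by
      have hs := Real.sum_le_exp_of_nonneg hm0 3
      simp [Finset.sum_range_succ, Nat.factorial] at hs
      linarith
    linarith
  have hE : Real.exp ((c + 1) * ((n : ℝ) + 1 / 2) - 4 * π ^ 2 * γ * ((n : ℝ) + 1 / 2) ^ 2)
      = Real.exp ((n : ℝ) + 1 / 2) * Real.exp (c * ((n : ℝ) + 1 / 2) - 4 * π ^ 2 * γ * ((n : ℝ) + 1 / 2) ^ 2) := by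
    rw [← Real.exp_add]; congr 1; ring
  rw [Real.norm_eq_abs, hE]
  set E := Real.exp (c * ((n : ℝ) + 1 / 2) - 4 * π ^ 2 * γ * ((n : ℝ) + 1 / 2) ^ 2) with hEdef
  have hE0 : 0 < E := Real.exp_pos _
  calc |(A + B * ((n : ℝ) + 1 / 2) ^ 2) * E| = |A + B * ((n : ℝ) + 1 / 2) ^ 2| * E := by
        rw [abs_mul, abs_of_pos hE0]
    _ ≤ (|A| + |B| * ((n : ℝ) + 1 / 2) ^ 2) * E := by
        gcongr
        calc |A + B * ((n : ℝ) + 1 / 2) ^ 2| ≤ |A| + |B * ((n : ℝ) + 1 / 2) ^ 2| := abs_add_le _ _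
          _ = |A| + |B| * ((n : ℝ) + 1 / 2) ^ 2 := by
              rw [abs_mul, abs_of_nonneg (by positivity : (0:ℝ) ≤ ((n : ℝ) + 1 / 2) ^ 2)]
    _ ≤ (|A| + |B| * (2 * Real.exp ((n : ℝ) + 1 / 2))) * E := by gcongr
    _ = |A * E| + 2 * |B| * (Real.exp ((n : ℝ) + 1 / 2) * E) := by rw [abs_mul, abs_of_pos hE0]; ring

/-- Termwise bound for (A.8) on the rectangle `|Re θ̌| ≤ X`, `|Im θ̌| ≤ Y`:
`‖term_n(θ̌)‖ ≤ (X + Y)(1 + 8π²γm²) e^{4πγmX − 4π²γm²}`, `m = n + ½`. [folklore] -/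
private theorem norm_termA8C_le_rect (hγ : 0 < γ) {X Y : ℝ} (n : ℕ) {θc : ℂ} (hre : |θc.re| ≤ X)
    (him : |θc.im| ≤ Y) :
    ‖termA8C γ n θc‖ ≤ (X + Y) * (1 + 8 * π ^ 2 * γ * ((n : ℝ) + 1 / 2) ^ 2) *
      Real.exp (4 * π * γ * X * ((n : ℝ) + 1 / 2) - 4 * π ^ 2 * γ * ((n : ℝ) + 1 / 2) ^ 2) := by
  have hπ : 0 < π := Real.pi_pos
  set m : ℝ := (n : ℝ) + 1 / 2 with hm
  have hm0 : 0 < m := by rw [hm]; positivity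
  set b : ℝ := 4 * π * γ * m with hb
  have hb0 : 0 < b := by positivity
  set w : ℂ := 4 * π * γ * ((n : ℂ) + 1 / 2) * θc with hw
  have hw' : w = (b : ℂ) * θc := by rw [hw, hb, hm]; push_cast; ring
  have hwre : w.re = b * θc.re := by rw [hw']; simp
  have hwnorm : ‖w‖ = b * ‖θc‖ := by rw [hw', norm_mul, Complex.norm_real, Real.norm_of_nonneg hb0.le]
  have hθn : ‖θc‖ ≤ X + Y := (Complex.norm_le_abs_re_add_abs_im θc).trans (add_le_add hre him)
  have hXY : 0 ≤ X + Y := (norm_nonneg _).trans hθn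
  have hbx : b * |θc.re| ≤ b * X := mul_le_mul_of_nonneg_left hre hb0.le
  have hcoef : (2 * (π : ℂ) * ((n : ℂ) + 1 / 2)) = ((2 * π * m : ℝ) : ℂ) := by rw [hm]; push_cast; ring
  have hE : Complex.exp (-(4 * π ^ 2 * γ * ((n : ℂ) + 1 / 2) ^ 2)) = ((Real.exp (-(4 * π ^ 2 * γ * m ^ 2)) : ℝ) : ℂ) := by
    rw [hm]; push_cast; ring_nf
  unfold termA8C
  rw [hE, norm_mul, Complex.norm_real, Real.norm_of_nonneg (Real.exp_pos _).le, ← hw]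
  have hcosh : ‖Complex.cosh w‖ ≤ Real.exp (b * X) := by
    refine (norm_cosh_le_exp_abs_re w).trans (Real.exp_le_exp.mpr ?_)
    rw [hwre, abs_mul, abs_of_pos hb0]; exact hbx
  have hsinh : ‖Complex.sinh w‖ ≤ b * (X + Y) * Real.exp (b * X) := by
    refine (norm_sinh_le w).trans ?_
    rw [hwnorm, hwre]
    have hc : Real.cosh (b * θc.re) ≤ Real.exp (b * X) := by
      refine (cosh_le_exp_abs'' _).trans (Real.exp_le_exp.mpr ?_)
      rw [abs_mul, abs_of_pos hb0]; exact hbx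
    exact mul_le_mul (mul_le_mul_of_nonneg_left hθn hb0.le) hc (by positivity) (by positivity)
  have h1 : ‖2 * π * ((n : ℂ) + 1 / 2) * Complex.sinh w - θc * Complex.cosh w‖
      ≤ (X + Y) * (1 + 8 * π ^ 2 * γ * m ^ 2) * Real.exp (b * X) := by
    calc ‖2 * π * ((n : ℂ) + 1 / 2) * Complex.sinh w - θc * Complex.cosh w‖
        ≤ ‖2 * (π : ℂ) * ((n : ℂ) + 1 / 2) * Complex.sinh w‖ + ‖θc * Complex.cosh w‖ := norm_sub_le _ _
      _ = 2 * π * m * ‖Complex.sinh w‖ + ‖θc‖ * ‖Complex.cosh w‖ := by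
          rw [norm_mul, hcoef, Complex.norm_real, Real.norm_of_nonneg (by positivity), norm_mul]
      _ ≤ 2 * π * m * (b * (X + Y) * Real.exp (b * X)) + (X + Y) * Real.exp (b * X) := by gcongr
      _ = (X + Y) * (1 + 8 * π ^ 2 * γ * m ^ 2) * Real.exp (b * X) := by rw [hb]; ring
  calc ‖2 * π * ((n : ℂ) + 1 / 2) * Complex.sinh w - θc * Complex.cosh w‖ * Real.exp (-(4 * π ^ 2 * γ * m ^ 2))
      ≤ (X + Y) * (1 + 8 * π ^ 2 * γ * m ^ 2) * Real.exp (b * X) * Real.exp (-(4 * π ^ 2 * γ * m ^ 2)) :=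
        mul_le_mul_of_nonneg_right h1 (Real.exp_pos _).le
    _ = (X + Y) * (1 + 8 * π ^ 2 * γ * m ^ 2) * Real.exp (4 * π * γ * X * m - 4 * π ^ 2 * γ * m ^ 2) := by
        rw [mul_assoc, ← Real.exp_add, hb]; ring_nf

/-- The series of (A.8) is entire. [cite: MullerSchiemann1987, Appendix (A.8) p.285 L.16–17] -/
theorem differentiable_tsum_termA8C (hγ : 0 < γ) : Differentiable ℂ fun θc => ∑' n : ℕ, termA8C γ n θc := by
  intro θ
  set X := |θ.re| + 1
  set Y := |θ.im| + 1
  have hopen : IsOpen {w : ℂ | |w.re| < X ∧ |w.im| < Y} :=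
    (isOpen_lt (continuous_abs.comp Complex.continuous_re) continuous_const).inter
      (isOpen_lt (continuous_abs.comp Complex.continuous_im) continuous_const)
  have hmem : θ ∈ {w : ℂ | |w.re| < X ∧ |w.im| < Y} := by simp [X, Y]
  have hs := summable_A8_majorant hγ (X + Y) ((X + Y) * (8 * π ^ 2 * γ)) (4 * π * γ * X)
  have hd : DifferentiableOn ℂ (fun w => ∑' n : ℕ, termA8C γ n w) {w : ℂ | |w.re| < X ∧ |w.im| < Y} := by
    refine Complex.differentiableOn_tsum_of_summable_norm hs
      (fun n => (differentiable_termA8C γ n).differentiableOn) hopen (fun n w hw => ?_)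
    refine (norm_termA8C_le_rect hγ n (le_of_lt hw.1) (le_of_lt hw.2)).trans (le_of_eq ?_)
    ring
  exact hd.differentiableAt (hopen.mem_nhds hmem)

/-- The series of (A.8) converges at every complex `θ̌`. [cite: MullerSchiemann1987, Appendix (A.8) p.285] -/
theorem summable_termA8C (hγ : 0 < γ) (θc : ℂ) : Summable fun n : ℕ => termA8C γ n θc := by
  have hs := summable_A8_majorant hγ (|θc.re| + |θc.im|) ((|θc.re| + |θc.im|) * (8 * π ^ 2 * γ)) (4 * π * γ * |θc.re|)
  refine Summable.of_norm_bounded hs fun n => ?_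
  refine (norm_termA8C_le_rect hγ n le_rfl le_rfl).trans (le_of_eq ?_)
  ring

/-- **(A.8) ON `ℂ`**: for every complex `θ̌`,
`h(π − θ̌) sin θ̌ = 𝒩′ e^{−γθ̌²} · 2Σ_{n≥0} [2π(n+½) sinh(4πγ(n+½)θ̌) − θ̌ cosh(4πγ(n+½)θ̌)] e^{−4π²γ(n+½)²}`
— the print's (A.8) `h(θ) = 𝒩′ (θ̌/sin θ̌) e^{−γθ̌²} Σ_{n≥1} e^{−4π²γ(n−½)²}{4π(n−½)θ̌⁻¹ sinh 4πγ(n−½)θ̌ − 2cosh 4πγ(n−½)θ̌}`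
(θ̌ = π − θ ∈ 𝒟̌) multiplied by `sin θ̌`: both sides are entire and agree on `ℝ`
(`MS87HeatKernelLargeGamma.h_mul_sin_eq_A8`). [cite: MullerSchiemann1987, Appendix (A.8) p.285] -/
theorem hC_mul_sin_eq_A8 (hγ : 0 < γ) (θc : ℂ) :
    hC γ (π - θc) * Complex.sin θc =
      (normN' γ : ℂ) * Complex.exp (-(γ * θc ^ 2)) * (2 * ∑' n : ℕ, termA8C γ n θc) := by
  have hf : Differentiable ℂ fun w : ℂ => hC γ (π - w) * Complex.sin w :=
    ((differentiable_hC hγ).comp ((differentiable_const _).sub differentiable_id)).mul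
      Complex.differentiable_sin
  have hg : Differentiable ℂ fun w : ℂ =>
      (normN' γ : ℂ) * Complex.exp (-(γ * w ^ 2)) * (2 * ∑' n : ℕ, termA8C γ n w) := by
    have h1 : Differentiable ℂ fun w : ℂ => (normN' γ : ℂ) * Complex.exp (-(γ * w ^ 2)) := by fun_prop
    exact h1.mul ((differentiable_const _).mul (differentiable_tsum_termA8C hγ))
  have key := eq_of_eqOn_real hf hg fun x => ?_
  · exact congrFun key θc
  -- on the real axis
  rw [← Complex.ofReal_sub, hC_ofReal hγ, ← Complex.ofReal_sin, ← Complex.ofReal_mul, h_mul_sin_eq_A8 hγ x]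
  push_cast
  rfl


/-- Termwise bound behind (A.11) on the strip `|Re θ̌| ≤ δ ≤ π/2`, `γ ≥ 1` (norm version of the real-axis estimate of
`MS87HeatKernelLargeGamma`): `‖term_n(θ̌)‖ ≤ ‖θ̌‖ e^{−γπ(π−2δ)} (1 + 8π²γm²) e^{−2π²nγ}`, `m = n + ½`, using
`‖sinh w‖ ≤ ‖w‖ cosh(Re w)`, `‖cosh w‖ ≤ e^{|Re w|}` and `4πγmδ − 4π²γm² ≤ −γπ(π−2δ) − 2π²nγ`.
[cite: MullerSchiemann1987, Appendix (A.11) p.285] -/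
private theorem norm_termA8C_le_strip (hγ : 1 ≤ γ) {δ : ℝ} (hδ : 0 < δ) (hδ2 : δ ≤ π / 2) (n : ℕ) {θc : ℂ}
    (hre : |θc.re| ≤ δ) :
    ‖termA8C γ n θc‖ ≤ ‖θc‖ * Real.exp (-(γ * π * (π - 2 * δ))) *
      ((1 + 8 * π ^ 2 * γ * ((n : ℝ) + 1 / 2) ^ 2) * Real.exp (-(2 * π ^ 2 * n * γ))) := by
  have hπ : 0 < π := Real.pi_pos
  have hγ0 : 0 < γ := by linarith
  set m : ℝ := (n : ℝ) + 1 / 2 with hm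
  have hm0 : 0 < m := by rw [hm]; positivity
  have hn0 : (0 : ℝ) ≤ n := n.cast_nonneg
  set b : ℝ := 4 * π * γ * m with hb
  have hb0 : 0 < b := by positivity
  set w : ℂ := 4 * π * γ * ((n : ℂ) + 1 / 2) * θc with hw
  have hw' : w = (b : ℂ) * θc := by rw [hw, hb, hm]; push_cast; ring
  have hwre : w.re = b * θc.re := by rw [hw']; simp
  have hwnorm : ‖w‖ = b * ‖θc‖ := by rw [hw', norm_mul, Complex.norm_real, Real.norm_of_nonneg hb0.le]
  have hbx : b * |θc.re| ≤ b * δ := mul_le_mul_of_nonneg_left hre hb0.le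
  have hcoef : (2 * (π : ℂ) * ((n : ℂ) + 1 / 2)) = ((2 * π * m : ℝ) : ℂ) := by rw [hm]; push_cast; ring
  have hE : Complex.exp (-(4 * π ^ 2 * γ * ((n : ℂ) + 1 / 2) ^ 2)) = ((Real.exp (-(4 * π ^ 2 * γ * m ^ 2)) : ℝ) : ℂ) := by
    rw [hm]; push_cast; ring_nf
  unfold termA8C
  rw [hE, norm_mul, Complex.norm_real, Real.norm_of_nonneg (Real.exp_pos _).le, ← hw]
  -- h1: the bracket
  have hcosh : ‖Complex.cosh w‖ ≤ Real.exp (b * δ) := by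
    refine (norm_cosh_le_exp_abs_re w).trans (Real.exp_le_exp.mpr ?_)
    rw [hwre, abs_mul, abs_of_pos hb0]; exact hbx
  have hsinh : ‖Complex.sinh w‖ ≤ b * ‖θc‖ * Real.exp (b * δ) := by
    refine (norm_sinh_le w).trans ?_
    rw [hwnorm, hwre]
    have hc : Real.cosh (b * θc.re) ≤ Real.exp (b * δ) := by
      refine (cosh_le_exp_abs'' _).trans (Real.exp_le_exp.mpr ?_)
      rw [abs_mul, abs_of_pos hb0]; exact hbx
    exact mul_le_mul_of_nonneg_left hc (by positivity)
  have h1 : ‖2 * π * ((n : ℂ) + 1 / 2) * Complex.sinh w - θc * Complex.cosh w‖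
      ≤ ‖θc‖ * (1 + 8 * π ^ 2 * γ * m ^ 2) * Real.exp (b * δ) := by
    calc ‖2 * π * ((n : ℂ) + 1 / 2) * Complex.sinh w - θc * Complex.cosh w‖
        ≤ ‖2 * (π : ℂ) * ((n : ℂ) + 1 / 2) * Complex.sinh w‖ + ‖θc * Complex.cosh w‖ := norm_sub_le _ _
      _ = 2 * π * m * ‖Complex.sinh w‖ + ‖θc‖ * ‖Complex.cosh w‖ := by
          rw [norm_mul, hcoef, Complex.norm_real, Real.norm_of_nonneg (by positivity), norm_mul]
      _ ≤ 2 * π * m * (b * ‖θc‖ * Real.exp (b * δ)) + ‖θc‖ * Real.exp (b * δ) := by gcongr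
      _ = ‖θc‖ * (1 + 8 * π ^ 2 * γ * m ^ 2) * Real.exp (b * δ) := by rw [hb]; ring
  -- h3: the exponent
  have h3 : b * δ + -(4 * π ^ 2 * γ * m ^ 2) ≤ -(γ * π * (π - 2 * δ)) + -(2 * π ^ 2 * n * γ) := by
    rw [hb, hm]
    have hk : 2 * π ^ 2 * (n : ℝ) ≤ 4 * π * n * (π * (n + 1) - δ) := by
      have : π / 2 ≤ π * ((n : ℝ) + 1) - δ := by nlinarith
      nlinarith [mul_nonneg (by positivity : (0:ℝ) ≤ 4 * π * n) (sub_nonneg.mpr this)]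
    have hid : 4 * π * γ * ((n : ℝ) + 1 / 2) * δ + -(4 * π ^ 2 * γ * ((n : ℝ) + 1 / 2) ^ 2)
        = -(γ * π * (π - 2 * δ)) - γ * (4 * π * n * (π * (n + 1) - δ)) := by ring
    rw [hid]
    nlinarith [mul_le_mul_of_nonneg_left hk hγ0.le]
  have hexp : Real.exp (b * δ) * Real.exp (-(4 * π ^ 2 * γ * m ^ 2))
      ≤ Real.exp (-(γ * π * (π - 2 * δ))) * Real.exp (-(2 * π ^ 2 * n * γ)) := by
    rw [← Real.exp_add, ← Real.exp_add]; exact Real.exp_le_exp.mpr h3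
  have hw0 : 0 ≤ Real.exp (-(4 * π ^ 2 * γ * m ^ 2)) := (Real.exp_pos _).le
  calc ‖2 * π * ((n : ℂ) + 1 / 2) * Complex.sinh w - θc * Complex.cosh w‖ * Real.exp (-(4 * π ^ 2 * γ * m ^ 2))
      ≤ ‖θc‖ * (1 + 8 * π ^ 2 * γ * m ^ 2) * Real.exp (b * δ) * Real.exp (-(4 * π ^ 2 * γ * m ^ 2)) :=
        mul_le_mul_of_nonneg_right h1 hw0
    _ = ‖θc‖ * (1 + 8 * π ^ 2 * γ * m ^ 2) * (Real.exp (b * δ) * Real.exp (-(4 * π ^ 2 * γ * m ^ 2))) := by ring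
    _ ≤ ‖θc‖ * (1 + 8 * π ^ 2 * γ * m ^ 2) *
          (Real.exp (-(γ * π * (π - 2 * δ))) * Real.exp (-(2 * π ^ 2 * n * γ))) :=
        mul_le_mul_of_nonneg_left hexp (by positivity)
    _ = _ := by ring

/-- The series `M₁₁` converges (copy of the private lemma of `MS87HeatKernelLargeGamma`). [folklore] -/
private theorem summable_MA11_term' :
    Summable fun n : ℕ => (1 + 8 * π ^ 2 * ((n : ℝ) + 3 / 2) ^ 2) * Real.exp (-(π ^ 2 * ((n : ℝ) + 1))) := by
  have hr : 0 < π ^ 2 := by positivity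
  have h0 := (summable_nat_add_iff 1).mpr (Real.summable_pow_mul_exp_neg_nat_mul 0 hr)
  have h1 := (summable_nat_add_iff 1).mpr (Real.summable_pow_mul_exp_neg_nat_mul 1 hr)
  have h2 := (summable_nat_add_iff 1).mpr (Real.summable_pow_mul_exp_neg_nat_mul 2 hr)
  refine (((h0.mul_left (1 + 2 * π ^ 2)).add (h1.mul_left (8 * π ^ 2))).add (h2.mul_left (8 * π ^ 2))).congr
    fun n => ?_
  push_cast
  ring_nf

/-- The weights summed: `Σ_n (1 + 8π²γ(n+½)²) e^{−2π²nγ} ≤ (1 + 2π²γ) + M₁₁` for `γ ≥ 1` (copy of the private lemma of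
`MS87HeatKernelLargeGamma`). [folklore] -/
private theorem tsum_A11_weights_le' (hγ : 1 ≤ γ) :
    ∑' n : ℕ, (1 + 8 * π ^ 2 * γ * ((n : ℝ) + 1 / 2) ^ 2) * Real.exp (-(2 * π ^ 2 * n * γ))
      ≤ (1 + 2 * π ^ 2 * γ) + MA11 := by
  have hπ : 0 < π := Real.pi_pos
  have hπ3 : (3 : ℝ) < π := Real.pi_gt_three
  have hγ0 : 0 < γ := by linarith
  set g : ℕ → ℝ := fun n => (1 + 8 * π ^ 2 * γ * ((n : ℝ) + 1 / 2) ^ 2) * Real.exp (-(2 * π ^ 2 * n * γ)) with hg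
  set b : ℕ → ℝ := fun n => (1 + 8 * π ^ 2 * ((n : ℝ) + 3 / 2) ^ 2) * Real.exp (-(π ^ 2 * ((n : ℝ) + 1))) with hb
  have hbs : Summable b := summable_MA11_term'
  have hγexp : ∀ n : ℕ, γ * Real.exp (-(2 * π ^ 2 * ((n : ℝ) + 1) * γ)) ≤ Real.exp (-(π ^ 2 * ((n : ℝ) + 1))) := by
    intro n
    have hn1 : (1 : ℝ) ≤ (n : ℝ) + 1 := by have : (0:ℝ) ≤ n := n.cast_nonneg; linarith
    have hsplit : Real.exp (-(2 * π ^ 2 * ((n : ℝ) + 1) * γ))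
        = Real.exp (-(π ^ 2 * ((n : ℝ) + 1) * γ)) * Real.exp (-(π ^ 2 * ((n : ℝ) + 1) * γ)) := by
      rw [← Real.exp_add]; congr 1; ring
    have ha : γ * Real.exp (-(π ^ 2 * ((n : ℝ) + 1) * γ)) ≤ 1 := by
      have h := Real.add_one_le_exp (π ^ 2 * ((n : ℝ) + 1) * γ)
      rw [Real.exp_neg, ← div_eq_mul_inv, div_le_one (Real.exp_pos _)]
      have hc : (1 : ℝ) ≤ π ^ 2 * ((n : ℝ) + 1) := by nlinarith
      have : γ ≤ π ^ 2 * ((n : ℝ) + 1) * γ := by nlinarith [mul_le_mul_of_nonneg_right hc hγ0.le]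
      linarith
    have hb' : Real.exp (-(π ^ 2 * ((n : ℝ) + 1) * γ)) ≤ Real.exp (-(π ^ 2 * ((n : ℝ) + 1))) := by
      apply Real.exp_le_exp.mpr
      nlinarith [mul_nonneg (by positivity : (0:ℝ) ≤ π ^ 2 * ((n : ℝ) + 1)) (sub_nonneg.mpr hγ)]
    calc γ * Real.exp (-(2 * π ^ 2 * ((n : ℝ) + 1) * γ))
        = (γ * Real.exp (-(π ^ 2 * ((n : ℝ) + 1) * γ))) * Real.exp (-(π ^ 2 * ((n : ℝ) + 1) * γ)) := by
          rw [hsplit]; ring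
      _ ≤ 1 * Real.exp (-(π ^ 2 * ((n : ℝ) + 1))) :=
          mul_le_mul ha hb' (Real.exp_pos _).le (by norm_num)
      _ = _ := one_mul _
  have hle : ∀ n : ℕ, g (n + 1) ≤ b n := by
    intro n
    simp only [hg, hb]
    push_cast
    have hE1 : Real.exp (-(2 * π ^ 2 * ((n : ℝ) + 1) * γ)) ≤ Real.exp (-(π ^ 2 * ((n : ℝ) + 1))) := by
      apply Real.exp_le_exp.mpr
      have : 0 ≤ π ^ 2 * ((n : ℝ) + 1) := by positivity
      nlinarith [mul_nonneg this (sub_nonneg.mpr hγ)]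
    have := hγexp n
    have h8 : 0 ≤ 8 * π ^ 2 * ((n : ℝ) + 1 + 1 / 2) ^ 2 := by positivity
    calc (1 + 8 * π ^ 2 * γ * ((n : ℝ) + 1 + 1 / 2) ^ 2) * Real.exp (-(2 * π ^ 2 * ((n : ℝ) + 1) * γ))
        = Real.exp (-(2 * π ^ 2 * ((n : ℝ) + 1) * γ))
          + 8 * π ^ 2 * ((n : ℝ) + 1 + 1 / 2) ^ 2 * (γ * Real.exp (-(2 * π ^ 2 * ((n : ℝ) + 1) * γ))) := by ring
      _ ≤ Real.exp (-(π ^ 2 * ((n : ℝ) + 1)))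
          + 8 * π ^ 2 * ((n : ℝ) + 1 + 1 / 2) ^ 2 * Real.exp (-(π ^ 2 * ((n : ℝ) + 1))) := by
          gcongr
      _ = (1 + 8 * π ^ 2 * ((n : ℝ) + 3 / 2) ^ 2) * Real.exp (-(π ^ 2 * ((n : ℝ) + 1))) := by ring
  have hgs1 : Summable fun n => g (n + 1) :=
    Summable.of_nonneg_of_le (fun n => by simp only [hg]; positivity) hle hbs
  have hgs : Summable g := (summable_nat_add_iff 1).mp hgs1
  rw [hgs.tsum_eq_zero_add]
  have hg0 : g 0 = 1 + 2 * π ^ 2 * γ := by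
    simp only [hg, Nat.cast_zero, zero_add, mul_zero, zero_mul, neg_zero, Real.exp_zero, mul_one]
    ring
  rw [hg0]
  have h2 : ∑' n, g (n + 1) ≤ MA11 := by
    rw [MA11]
    exact Summable.tsum_le_tsum hle hgs1 hbs
  linarith

/-- `‖Σ (A.8)-terms‖ ≤ ‖θ̌‖ e^{−γπ(π−2δ)} ((1 + 2π²γ) + M₁₁)` for `γ ≥ 1`, `|Re θ̌| ≤ δ ≤ π/2`.
[cite: MullerSchiemann1987, Appendix (A.11) p.285] -/
private theorem norm_tsum_termA8C_le (hγ : 1 ≤ γ) {δ : ℝ} (hδ : 0 < δ) (hδ2 : δ ≤ π / 2) {θc : ℂ}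
    (hre : |θc.re| ≤ δ) :
    ‖∑' n : ℕ, termA8C γ n θc‖ ≤ ‖θc‖ * Real.exp (-(γ * π * (π - 2 * δ))) * ((1 + 2 * π ^ 2 * γ) + MA11) := by
  have hγ0 : 0 < γ := by linarith
  set W : ℕ → ℝ := fun n => (1 + 8 * π ^ 2 * γ * ((n : ℝ) + 1 / 2) ^ 2) * Real.exp (-(2 * π ^ 2 * n * γ)) with hW
  have hWs : Summable W := by
    have hr : 0 < 2 * π ^ 2 * γ := by positivity
    have h0 := Real.summable_pow_mul_exp_neg_nat_mul 0 hr
    have h1 := Real.summable_pow_mul_exp_neg_nat_mul 1 hr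
    have h2 := Real.summable_pow_mul_exp_neg_nat_mul 2 hr
    refine (((h0.mul_left (1 + 2 * π ^ 2 * γ)).add (h1.mul_left (8 * π ^ 2 * γ))).add
      (h2.mul_left (8 * π ^ 2 * γ))).congr fun n => ?_
    simp only [hW]
    ring_nf
  have hmaj := (hWs.mul_left (‖θc‖ * Real.exp (-(γ * π * (π - 2 * δ))))).hasSum
  have h := tsum_of_norm_bounded hmaj (fun n => norm_termA8C_le_strip hγ hδ hδ2 n hre)
  rw [tsum_mul_left] at h
  refine h.trans ?_
  exact mul_le_mul_of_nonneg_left (tsum_A11_weights_le' hγ) (by positivity)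

/-- `M₁₁ ≥ 0`. [folklore] -/
private theorem MA11_nonneg' : 0 ≤ MA11 := by
  unfold MA11; exact tsum_nonneg fun n => by positivity

/-- **(A.11) on the whole strip `{|Re θ̌| ≤ δ}`**, uniformly in `γ ≥ 1` and in `Im θ̌`, explicit: for `0 < δ ≤ π/2`,
`γ ≥ 1` and every complex `θ̌` with `|Re θ̌| ≤ δ`,
`‖h(π − θ̌)‖ ≤ 2π((1 + 2π²γ) + M₁₁) e^{−γπ(π−2δ) + γ(Im θ̌)² − γ(Re θ̌)²}` (`M₁₁ = MA11`) — the print's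
«|h(θ)| ≤ exp{−γπ(π − 2δ) − γ Re θ̌² + 𝒪(ln γ)}, |Re θ̌| ≤ δ» with `Re(θ̌²) = (Re θ̌)² − (Im θ̌)²` and the `𝒪(ln γ)`
explicit: from (A.8) on `ℂ`, the termwise bound, (A.9) `𝒩′ ≤ 2`, Jordan's `‖θ̌‖ ≤ (π/2)‖sin θ̌‖` on `|Re θ̌| ≤ π/2`;
at `θ̌ = 0` from the real-axis bound. [cite: MullerSchiemann1987, Appendix (A.11) p.285] -/
theorem norm_hC_le_A11 (hγ : 1 ≤ γ) {δ : ℝ} (hδ : 0 < δ) (hδ2 : δ ≤ π / 2) {θc : ℂ} (hre : |θc.re| ≤ δ) :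
    ‖hC γ (π - θc)‖ ≤ 2 * π * ((1 + 2 * π ^ 2 * γ) + MA11) *
      Real.exp (-(γ * π * (π - 2 * δ)) + γ * θc.im ^ 2 - γ * θc.re ^ 2) := by
  have hγ0 : 0 < γ := by linarith
  have hπ : 0 < π := Real.pi_pos
  have hπ3 : (3 : ℝ) < π := Real.pi_gt_three
  have hM := MA11_nonneg'
  set K : ℝ := (1 + 2 * π ^ 2 * γ) + MA11 with hK
  have hK0 : 0 < K := by rw [hK]; positivity
  have hN1 : 1 ≤ normN' γ := one_le_normN' (by
    have : 1 / (8 * π ^ 2) ≤ 1 := by rw [div_le_one (by positivity)]; nlinarith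
    linarith)
  have hN2 := normN'_le_two hγ
  by_cases hθ : θc = 0
  · subst hθ
    have hreal := h_le_A11 hγ hδ hδ2 (θc := 0) (by simpa using hδ.le)
    rw [sub_zero] at hreal ⊢
    have h1 : hC γ (π : ℂ) = ((h γ π : ℝ) : ℂ) := hC_ofReal hγ0 π
    rw [h1, Complex.norm_real, Real.norm_of_nonneg (h_pos hγ0 π).le]
    simp only [Complex.zero_re, Complex.zero_im]
    have he : Real.exp (-(γ * π * (π - 2 * δ)) - γ * (0:ℝ) ^ 2) =
        Real.exp (-(γ * π * (π - 2 * δ)) + γ * (0:ℝ) ^ 2 - γ * (0:ℝ) ^ 2) := by congr 1; ring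
    rw [← he]; exact hreal
  -- sin θc ≠ 0 on the strip
  have hsin : Complex.sin θc ≠ 0 := by
    intro h0
    obtain ⟨k, hk⟩ := Complex.sin_eq_zero_iff.mp h0
    have hkre : θc.re = k * π := by rw [hk]; simp
    have hk0 : k ≠ 0 := by
      rintro rfl
      apply hθ
      rw [hk]; simp
    have hk1 : (1 : ℝ) ≤ |(k : ℝ)| := by
      rw [← Int.cast_abs]; exact_mod_cast Int.one_le_abs hk0
    have : π ≤ |θc.re| := by
      rw [hkre, abs_mul, abs_of_pos hπ]; nlinarith
    linarith
  have hs0 : 0 < ‖Complex.sin θc‖ := norm_pos_iff.mpr hsin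
  have hjordan : ‖θc‖ ≤ π / 2 * ‖Complex.sin θc‖ := by
    have hj := norm_sin_ge_of_abs_re_le θc (hre.trans hδ2)
    have := mul_le_mul_of_nonneg_left hj (by positivity : (0:ℝ) ≤ π / 2)
    have e : π / 2 * (2 / π * ‖θc‖) = ‖θc‖ := by field_simp
    linarith [e]
  have hE : ‖Complex.exp (-(γ * θc ^ 2))‖ = Real.exp (γ * θc.im ^ 2 - γ * θc.re ^ 2) := by
    rw [Complex.norm_exp]; congr 1; simp [Complex.mul_re, pow_two]; ring
  have hprod : ‖hC γ (π - θc)‖ * ‖Complex.sin θc‖ ≤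
      2 * Real.exp (γ * θc.im ^ 2 - γ * θc.re ^ 2) * (2 * (‖θc‖ * Real.exp (-(γ * π * (π - 2 * δ))) * K)) := by
    rw [← norm_mul, hC_mul_sin_eq_A8 hγ0, norm_mul, norm_mul, Complex.norm_real,
      Real.norm_of_nonneg (by linarith), hE, norm_mul, Complex.norm_two]
    have hS := norm_tsum_termA8C_le hγ hδ hδ2 hre
    have h0 : 0 ≤ Real.exp (γ * θc.im ^ 2 - γ * θc.re ^ 2) := (Real.exp_pos _).le
    exact mul_le_mul (mul_le_mul_of_nonneg_right hN2 h0) (mul_le_mul_of_nonneg_left hS (by norm_num))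
      (by positivity) (by positivity)
  have key : ‖hC γ (π - θc)‖ * ‖Complex.sin θc‖ ≤
      (2 * π * K * Real.exp (-(γ * π * (π - 2 * δ)) + γ * θc.im ^ 2 - γ * θc.re ^ 2)) * ‖Complex.sin θc‖ := by
    have hsplit : Real.exp (-(γ * π * (π - 2 * δ)) + γ * θc.im ^ 2 - γ * θc.re ^ 2)
        = Real.exp (-(γ * π * (π - 2 * δ))) * Real.exp (γ * θc.im ^ 2 - γ * θc.re ^ 2) := by
      rw [← Real.exp_add]; congr 1; ring
    calc ‖hC γ (π - θc)‖ * ‖Complex.sin θc‖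
        ≤ 2 * Real.exp (γ * θc.im ^ 2 - γ * θc.re ^ 2) * (2 * (‖θc‖ * Real.exp (-(γ * π * (π - 2 * δ))) * K)) := hprod
      _ = (4 * K * Real.exp (-(γ * π * (π - 2 * δ))) * Real.exp (γ * θc.im ^ 2 - γ * θc.re ^ 2)) * ‖θc‖ := by ring
      _ ≤ (4 * K * Real.exp (-(γ * π * (π - 2 * δ))) * Real.exp (γ * θc.im ^ 2 - γ * θc.re ^ 2)) *
            (π / 2 * ‖Complex.sin θc‖) := mul_le_mul_of_nonneg_left hjordan (by positivity)
      _ = (2 * π * K * Real.exp (-(γ * π * (π - 2 * δ)) + γ * θc.im ^ 2 - γ * θc.re ^ 2)) * ‖Complex.sin θc‖ := by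
          rw [hsplit]; ring
  exact le_of_mul_le_mul_right key hs0

/-- **(A.11) as printed, on the strip**: for `0 < δ ≤ π/2` there are `A, B > 0` with
`‖h(π − θ̌)‖ ≤ exp{−γπ(π − 2δ) − γ Re(θ̌²) + log(A + Bγ)}` for all `γ ≥ 1` and all complex `θ̌` with `|Re θ̌| ≤ δ` —
«|h(θ)| ≤ exp{−γπ(π − 2δ) − γ Re θ̌² + 𝒪(ln γ)}, |Re θ̌| ≤ δ». [cite: MullerSchiemann1987, Appendix (A.11) p.285] -/
theorem norm_hC_le_exp_A11 {δ : ℝ} (hδ : 0 < δ) (hδ2 : δ ≤ π / 2) : ∃ A B : ℝ, 0 < A ∧ 0 < B ∧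
    ∀ γ : ℝ, 1 ≤ γ → ∀ θc : ℂ, |θc.re| ≤ δ →
      ‖hC γ (π - θc)‖ ≤ Real.exp (-(γ * π * (π - 2 * δ)) - γ * (θc ^ 2).re + Real.log (A + B * γ)) := by
  have hπ : 0 < π := Real.pi_pos
  have hM := MA11_nonneg'
  refine ⟨2 * π * (1 + MA11), 2 * π * (2 * π ^ 2), by positivity, by positivity, fun γ hγ θc hre => ?_⟩
  have hK : 0 < 2 * π * (1 + MA11) + 2 * π * (2 * π ^ 2) * γ := by
    have : 0 < γ := by linarith
    positivity
  refine (norm_hC_le_A11 hγ hδ hδ2 hre).trans (le_of_eq ?_)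
  rw [Real.exp_add, Real.exp_log hK]
  have hre2 : (θc ^ 2).re = θc.re ^ 2 - θc.im ^ 2 := by simp [Complex.mul_re, pow_two]
  rw [hre2]
  have : -(γ * π * (π - 2 * δ)) + γ * θc.im ^ 2 - γ * θc.re ^ 2
      = -(γ * π * (π - 2 * δ)) - γ * (θc.re ^ 2 - θc.im ^ 2) := by ring
  rw [this]
  ring

end A11Strip

end HeatKernel

end MullerSchiemann1987

end Literature.MathematicalPhysics.QuantumFieldTheory
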